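import Mathlib
import HarnessLib
import Summits.NavierStokesRegularity.NavierStokesRegularity.Theses.PoloidalWindowDoor
import Summits.NavierStokesRegularity.NavierStokesRegularity.Theorems.PoloidalWindowDoorPoloidalWindowRigidityLargeScaleMomentum
import Summits.NavierStokesRegularity.NavierStokesRegularity.Theorems.PoloidalWindowDoorPoloidalWindowRigidityZeroMeanMomentum
import Summits.NavierStokesRegularity.NavierStokesRegularity.Theorems.PoloidalWindowDoorPoloidalWindowRigidityFluxTransport
import Literature.Analysis.FluidPDE.FlatSwirlGauge
import Literature.Analysis.UnboundedOperators.WeightedGreenIdentity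

/-!
# Crux `PoloidalWindowRigidity` (K2, stmt-NavierStokesRegularity-19708) — LINE 16 `zero_mode`, v2.1 «zero_mode_bump» (SORRY-FREE)
# (IDEATOR seat ns-idea-8, generation 8; lens «barrier»; bears_on LADDER-NS N0, rung N0-LocalTubeDoorPoloidal)

WHY THIS REVISION (erratum-driven, 2026-08-29).  LINE 16 v1.1 (`Lines/zero_mode.lean`) kills hot_split's cell C1 (the hot
constant plane) from the zero-mode law Z stated on FLAT BOXES, whose Oseen half `stub_zeroModeOseen` is L-sized (a three-region
box estimate of the Oseen–Duhamel term, `…ZeroModeRadial`).  That labour is unnecessary: the tree ALREADY contains the zero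
mode in BUMP form —

* `…LargeScaleMomentum.abs_integral_mul_inner_sub_le` (nsreg-p7 g6, 2026-08-27): for EVERY test function `θ` and bounded
  Oseen-mild `v`, `|∫θ⟪v(t) − v(s), e⟫| ≤ ‖e‖(t−s)[M∫|Δθ| + M²(∫‖Dθ‖ + 2^{3/2}·2R∫‖D²θ‖ + K(2/R)∫|θ|)]` — the Oseen term is
  INCLUDED (via `…DuhamelBump`);
* `…ZeroMeanMomentum` (nsreg-p7 g7): the large-scale mean velocity is zero on every slice (pair form);
* `…HorizontalMean.abs_hmean_fderiv_horizontal_le` (K2-p2 g2): horizontal divergences have plane means `O(1/R)` (= flux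
  transport in bump form).

So C1 closes at FIXED ASPECT RATIO `λ` with smooth bumps, with NO box Oseen estimate, no logarithm, no layer cake:

* **ZB `ZeroModeBumpLaw` (PROVED below, from `abs_integral_mul_inner_sub_le` + the Type-I far past)** — for a class profile, `t < 0`,
  and ANY family of test functions `θ_R` (`R ≥ 1`) with `tsupport θ_R ⊆ B̄(0,2R)`, `|θ_R| ≤ 1`, `‖Dθ_R‖ ≤ a/R`, `‖D²θ_R‖ ≤ a/R²`,
  `|Δθ_R| ≤ a/R²`: `∀ ε > 0, ∃ R₀, ∀ R ≥ R₀, |∫ θ_R ⟪v(t), e⟫| ≤ ε R³`.  (Far past `s'` with `C/√(−s') ≪ ε`, then the momentum defect on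
  `[s', t]` is `O((t − s')R²)`.)
* **FB `BumpFluxTransport` (PROVED below, v2.1; `bumpFluxTransport`, alias `stub_bumpFluxTransport`)** — on a hot plane `{y₂ = 0}`
  (`v₂(t,·) ≡ N` there) there are `μ = 2` and `K = 128·sup|χ'_{1/2}|·C/√(−t)` such that for every aspect ratio `0 < λ ≤ 1/4` the PRODUCT
  BUMP family `θ_R(x) = χ_{1/2}(x₀/R)·χ_{1/2}(x₁/R)·χ_λ(x₂/R − 2λ)` (`χ_ρ = Literature.Analysis.FluidPDE.cutoff (E := ℝ) ρ`) is admissible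
  (ZB-constants `a = a(λ)` by SCALING `θ_R = Θ_λ(·/R)`: `Dθ_R = R⁻¹DΘ_λ`, `D²θ_R = R⁻²D²Θ_λ`, `Δθ_R = R⁻²ΔΘ_λ`, `|Δf| ≤ 3‖D²f‖`, and
  continuity + compact support of `DΘ_λ`, `D²Θ_λ`), has MASS `∫θ_R ≥ 2λR³` (it equals `1` on `[−R/2,R/2]²×[λR,3λR]`) and FLUX DEFECT
  `|∫θ_R v₂(t) − N∫θ_R| ≤ Kλ²R³`: TWO applications of Mathlib's box divergence theorem
  (`MeasureTheory.integral_divergence_of_hasFDerivAt_off_countable`, as in `…FluxTransport`, K2-p2 p680813) on `[−R,R]²×[0,4λR]`, to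
  `Ψ·v(t)` and to `Ψ·e₂` with `Ψ(p) = χ_{1/2}(p₀/R)χ_{1/2}(p₁/R)H(p₂)`, `H(z) = ∫_z^{4λR} χ_λ(s/R − 2λ) ds` (so `∂₂Ψ = −θ_R`, `Ψ = 0` on the
  lateral and top faces, and the bottom-face integrals `N·∫Ψ(·,0)` resp. `∫Ψ(·,0)` CANCEL without being computed):
  `∫θ_R (v₂ − N) = ∫ H·(∂₀(χχ)v₀ + ∂₁(χχ)v₁) = O(4λR · sup|χ'|/R · C/√(−t) · 16λR³)`.
* **KERNEL `noHotPlane_of_bump : ZB → FB → NoHotPlane` (PROVED, real arithmetic)**: with `N ≠ 0` choose `λ = min ¼ (μ|N|/(4(K+1)))`, then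
  `ε = μλ|N|/4` in ZB: `|N|μλR³ ≤ |N|∫θ_R ≤ |∫θ_R v₂| + Kλ²R³ ≤ μλ|N|R³/2`, absurd.
* `cellC1_of_noHotPlane` (VERBATIM hot_split `stub_cellC1`, as in v1.1) ⇒ **cell C1 of hot_split is PROVED on this line (sorry-free, v2.1)**.

RELATION TO v1.1.  v1.1's `FluxTransport` (F, landed p680813), `ZeroModeHeat` (landed p681062) stay valid tree facts; v1.1's L-stub
`stub_zeroModeOseen` is SUPERSEDED by ZB + FB (both proved here).  HL3′ residue after this file: **C2a ∧ C2b** (was: C2a ∧ C2b ∧ Z-oseen(L)).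

HONEST LABEL (P16-4 + erratum 2026-08-29).  The LEVER of LINE 16 (conserved / vanishing large-scale mean) PRE-EXISTS in the tree
(`…LargeScaleMomentum`, `…ZeroMeanMomentum`, 2026-08-27); LINE 16 is a new APPLICATION of it (cell C1), not a new tool.  No summit is
proved by any line; NS regularity is NOT proved; `PoloidalWindowRigidity` (19708), `LrcModEntire` (20428), ⟨27893⟩, 22881 remain OPEN;
hot_loops v4.3 is the ⟨19708⟩ skeleton of record.  Sorries in this file: NONE (v2.1; v2 had `stub_bumpFluxTransport`).  Landing: this seat is
files-only — a prover/typer seat may port §FB + ZB + kernel to `Theorems/PoloidalWindowDoorPoloidalWindowRigidityZeroModeBump.lean` (two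
deprecated simp-lemma names `ContinuousLinearMap.smul_apply/add_apply` to modernise).
-/

noncomputable section

set_option linter.dupNamespace false

namespace Summit.NavierStokesRegularity.NavierStokesRegularity.Cruxes.PoloidalWindowRigidity.ZeroModeBump

open MeasureTheory Set Function Filter Topology Metric InnerProductSpace
open scoped RealInnerProductSpace Laplacian
open Literature.Analysis Literature.Analysis.FluidPDE Literature.Analysis.UnboundedOperators
open Summit.NavierStokesRegularity.NavierStokesRegularity.Theorems.LocalSineTubeDoorProfileAlignedWindowRigidityAncient
open Summit.NavierStokesRegularity.NavierStokesRegularity.Theorems.PoloidalWindowDoorPoloidalWindowRigidityLargeScaleMomentum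
open Summit.NavierStokesRegularity.NavierStokesRegularity.Theorems.PoloidalWindowDoorPoloidalWindowRigidityZeroMeanMomentum
open Summit.NavierStokesRegularity.NavierStokesRegularity.Theorems.PoloidalWindowDoorPoloidalWindowRigidityFluxTransport
  (boxLo_le_boxHi measurableEmbedding_ofLp setIntegral_flatBox)
open Summit.NavierStokesRegularity.NavierStokesRegularity.Theorems.PoloidalWindowDoorPoloidalWindowRigidityTypeIAnalytic
  (typeI_mild_slice_analytic)

local notation "E3" => EuclideanSpace ℝ (Fin 3)

/-! ## The admissible bump families -/

/-- **Admissible test-function family at scale `R ≥ 1` with derivative constant `a`**: smooth, compactly supported in `B̄(0,2R)`,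
`|θ| ≤ 1`, `‖Dθ‖ ≤ a/R`, `‖D²θ‖ ≤ a/R²`, `|Δθ| ≤ a/R²`. -/
def IsBumpFamily (a : ℝ) (θ : ℝ → E3 → ℝ) : Prop :=
  ∀ R : ℝ, 1 ≤ R →
    FunctionSpaces.IsTestFunctionOn (⊤ : TopologicalSpace.Opens E3) (θ R) ∧
    tsupport (θ R) ⊆ closedBall (0 : E3) (2 * R) ∧
    (∀ x, |θ R x| ≤ 1) ∧
    (∀ x, ‖fderiv ℝ (θ R) x‖ ≤ a / R) ∧
    (∀ x, ‖fderiv ℝ (fderiv ℝ (θ R)) x‖ ≤ a / R ^ 2) ∧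
    (∀ x, |(Δ (θ R)) x| ≤ a / R ^ 2)

/-! ## ZB — the zero-mode law for bump families (PROVED) -/

/-- **ZB — zero-mode law, bump form.**  For a profile of the route's Type-I class, every `t < 0`, every admissible bump family and every
direction `e`: `∫ θ_R ⟪v(t), e⟫ = o(R³)`. -/
def ZeroModeBumpLaw : Prop :=
  ∀ (C : ℝ) (v : ℝ → E3 → E3),
    HasTypeITimeDecay C v →
    ContinuousOn (uncurry v) (Iio (0 : ℝ) ×ˢ univ) →
    (∀ s t : ℝ, s < t → t < 0 → ∀ x, v t x = heatExtension (v s) (t - s) x - oseenDuhamel 1 s v v t x) →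
    ∀ t : ℝ, t < 0 → ∀ (a : ℝ) (θ : ℝ → E3 → ℝ), 0 ≤ a → IsBumpFamily a θ →
      ∀ (e : E3) (ε : ℝ), 0 < ε → ∃ R₀ : ℝ, 1 ≤ R₀ ∧ ∀ R : ℝ, R₀ ≤ R → |∫ x, θ R x * ⟪v t x, e⟫| ≤ ε * R ^ 3

variable {C : ℝ} {v : ℝ → E3 → E3}

/-- The momentum defect of an admissible bump on a window `[s', t]`: `O((t − s')R²)` with a constant depending on the class bound at `t` only. -/
theorem abs_defect_le (hrate : HasTypeITimeDecay C v)
    (hcont : ContinuousOn (uncurry v) (Iio (0 : ℝ) ×ˢ univ))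
    (hmild : ∀ s t : ℝ, s < t → t < 0 → ∀ x, v t x = heatExtension (v s) (t - s) x - oseenDuhamel 1 s v v t x)
    {t : ℝ} (ht : t < 0) {a : ℝ} (ha : 0 ≤ a) {θ : ℝ → E3 → ℝ} (hθ : IsBumpFamily a θ) :
    ∃ K : ℝ, 0 ≤ K ∧ ∀ s' : ℝ, s' < t → ∀ R : ℝ, 1 ≤ R → ∀ e : E3,
      |∫ x, θ R x * ⟪v t x - v s' x, e⟫| ≤ ‖e‖ * (t - s') * (K * R ^ 2) := by
  -- the bound `M = C/√(−t)` on the whole past of `t`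
  set M : ℝ := C / Real.sqrt (-t) with hM
  have hM0 : 0 ≤ M := (norm_nonneg _).trans (hrate t ht 0)
  have hC0 : 0 ≤ C := by
    by_contra hC
    push Not at hC
    have h1 := div_neg_of_neg_of_pos hC (Real.sqrt_pos.2 (neg_pos.2 ht))
    linarith [(norm_nonneg (v t 0)).trans (hrate t ht 0)]
  have hMall : ∀ τ ≤ t, ∀ y, ‖v τ y‖ ≤ M := by
    intro τ hτ y
    have hτ0 : τ < 0 := lt_of_le_of_lt hτ ht
    refine (hrate τ hτ0 y).trans ?_
    exact div_le_div_of_nonneg_left hC0 (Real.sqrt_pos.2 (neg_pos.2 ht)) (Real.sqrt_le_sqrt (by linarith))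
  -- the dimensional constants of the momentum lemma and the unit-ball volume
  set κ : ℝ := (2 : ℝ) ^ ((Module.finrank ℝ E3 : ℝ) / 2) with hκ
  have hκ0 : 0 ≤ κ := by positivity
  set V₁ : ℝ := volume.real (closedBall (0 : E3) 1) with hV₁
  have hV₁0 : 0 ≤ V₁ := measureReal_nonneg
  refine ⟨(M * a + M ^ 2 * (a + κ * 2 * a + (3 / 2 * κ + 8 * 64 * κ ^ 3) * 2)) * (8 * V₁), by positivity,
    fun s' hs' R hR e => ?_⟩
  have hR0 : 0 < R := by linarith
  have hs'0 : s' < 0 := hs'.trans ht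
  obtain ⟨hθt, hsupp, h0, h1, h2, hΔ⟩ := hθ R hR
  -- the volume of the supporting ball `B̄(0,2R)` is `8R³V₁`
  set V2 : ℝ := volume.real (closedBall (0 : E3) (2 * R)) with hV2
  have hV2eq : V2 = 8 * R ^ 3 * V₁ := by
    rw [hV2, hV₁, Measure.addHaar_real_closedBall' volume (0 : E3) (by positivity : (0 : ℝ) ≤ 2 * R),
      finrank_euclideanSpace_fin]
    ring
  have hV20 : 0 ≤ V2 := measureReal_nonneg
  -- hypotheses of the momentum lemma on the window `(s', t)`
  have hsub : Ioo s' t ×ˢ (univ : Set E3) ⊆ Iio 0 ×ˢ univ :=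
    prod_mono (fun τ hτ => lt_trans hτ.2 ht) subset_rfl
  have hmeas : AEStronglyMeasurable (uncurry v) (volume.restrict (Ioo s' t ×ˢ univ)) :=
    (hcont.mono hsub).aestronglyMeasurable (measurableSet_Ioo.prod MeasurableSet.univ)
  have h := abs_integral_mul_inner_sub_le hs' hM0 hR0 hmeas (fun τ hτ y => hMall τ hτ.2.le y)
    (continuous_slice hcont hs'0) (continuous_slice hcont ht) (fun y => hMall s' hs'.le y) (fun y => hMall t le_rfl y)
    (hmild s' t hs' ht) hθt e
  -- the four `L¹` sizes (sup × volume of the support)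
  set ζ : E3 → ℝ := θ R with hζ
  have hout : ∀ x, x ∉ closedBall (0 : E3) (2 * R) → x ∉ tsupport ζ := fun x hx h' => hx (hsupp h')
  have hI0 : ∫ x, |ζ x| ≤ 1 * V2 := by
    have := integral_norm_le_of_le_of_support (f := ζ) (R := R) (A := 1)
      (fun x => by rw [Real.norm_eq_abs]; exact h0 x)
      (fun x hx => image_eq_zero_of_notMem_tsupport (hout x hx))
    simpa [Real.norm_eq_abs] using this
  have hI1 : ∫ x, ‖fderiv ℝ ζ x‖ ≤ a / R * V2 := by
    refine integral_norm_le_of_le_of_support (F := E3 →L[ℝ] ℝ) (f := fderiv ℝ ζ)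
      (fun x => ?_) (fun x hx => fderiv_of_notMem_tsupport ℝ (hout x hx))
    exact h1 x
  have hI2 : ∫ x, ‖fderiv ℝ (fderiv ℝ ζ) x‖ ≤ a / R ^ 2 * V2 := by
    refine integral_norm_le_of_le_of_support (F := E3 →L[ℝ] (E3 →L[ℝ] ℝ)) (f := fderiv ℝ (fderiv ℝ ζ))
      (fun x => ?_) (fun x hx => ?_)
    · exact h2 x
    · have hx' : x ∉ tsupport (fderiv ℝ ζ) := fun h' => hout x hx (tsupport_fderiv_subset ℝ h')
      exact fderiv_of_notMem_tsupport ℝ hx'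
  have hIΔ : ∫ x, ‖(Δ ζ) x‖ ≤ a / R ^ 2 * V2 := by
    refine integral_norm_le_of_le_of_support (fun x => ?_) (fun x hx => ?_)
    · rw [Real.norm_eq_abs]; exact hΔ x
    · exact FluidPDE.laplacian_eq_zero_of_notMem_tsupport (hout x hx)
  -- collect: every size is `≤ (const) · V2 / R` since `R ≥ 1`
  have hR1 : 1 / R ^ 2 ≤ 1 / R := by
    rw [div_le_div_iff₀ (by positivity) hR0]; nlinarith
  have e1 : M * (∫ x, ‖(Δ ζ) x‖) ≤ M * a * (V2 / R) := by
    have : a / R ^ 2 * V2 ≤ a * (V2 / R) := by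
      have := mul_le_mul_of_nonneg_left hR1 (mul_nonneg ha hV20)
      calc a / R ^ 2 * V2 = a * V2 * (1 / R ^ 2) := by ring
        _ ≤ a * V2 * (1 / R) := this
        _ = a * (V2 / R) := by ring
    nlinarith [mul_le_mul_of_nonneg_left (hIΔ.trans this) hM0]
  have e2 : (∫ x, ‖fderiv ℝ ζ x‖) ≤ a * (V2 / R) := by
    calc (∫ x, ‖fderiv ℝ ζ x‖) ≤ a / R * V2 := hI1
      _ = a * (V2 / R) := by ring
  have e3 : κ * (2 * R) * (∫ x, ‖fderiv ℝ (fderiv ℝ ζ) x‖) ≤ κ * 2 * a * (V2 / R) := by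
    have h3 := mul_le_mul_of_nonneg_left hI2 (by positivity : 0 ≤ κ * (2 * R))
    calc κ * (2 * R) * (∫ x, ‖fderiv ℝ (fderiv ℝ ζ) x‖) ≤ κ * (2 * R) * (a / R ^ 2 * V2) := h3
      _ = κ * 2 * a * (V2 / R) := by field_simp
  have e4 : (3 / 2 * κ + 8 * 64 * κ ^ 3) * (2 / R) * (∫ x, |ζ x|) ≤ (3 / 2 * κ + 8 * 64 * κ ^ 3) * 2 * (V2 / R) := by
    have h4 := mul_le_mul_of_nonneg_left hI0 (by positivity : 0 ≤ (3 / 2 * κ + 8 * 64 * κ ^ 3) * (2 / R))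
    calc (3 / 2 * κ + 8 * 64 * κ ^ 3) * (2 / R) * (∫ x, |ζ x|)
        ≤ (3 / 2 * κ + 8 * 64 * κ ^ 3) * (2 / R) * (1 * V2) := h4
      _ = (3 / 2 * κ + 8 * 64 * κ ^ 3) * 2 * (V2 / R) := by field_simp
  refine h.trans ?_
  have hes : 0 ≤ ‖e‖ * (t - s') := mul_nonneg (norm_nonneg _) (by linarith)
  have hsum : M * (∫ x, ‖(Δ ζ) x‖) + M ^ 2 * ((∫ x, ‖fderiv ℝ ζ x‖) +
      κ * (2 * R) * (∫ x, ‖fderiv ℝ (fderiv ℝ ζ) x‖) + (3 / 2 * κ + 8 * 64 * κ ^ 3) * (2 / R) * (∫ x, |ζ x|)) ≤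
      (M * a + M ^ 2 * (a + κ * 2 * a + (3 / 2 * κ + 8 * 64 * κ ^ 3) * 2)) * V2 / R := by
    have hM2 : 0 ≤ M ^ 2 := sq_nonneg _
    have := add_le_add e1 (mul_le_mul_of_nonneg_left (add_le_add (add_le_add e2 e3) e4) hM2)
    refine this.trans (le_of_eq ?_)
    ring
  have hfin : (M * a + M ^ 2 * (a + κ * 2 * a + (3 / 2 * κ + 8 * 64 * κ ^ 3) * 2)) * V2 / R =
      (M * a + M ^ 2 * (a + κ * 2 * a + (3 / 2 * κ + 8 * 64 * κ ^ 3) * 2)) * (8 * V₁) * R ^ 2 := by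
    rw [hV2eq]; field_simp
  calc ‖e‖ * (t - s') * (M * (∫ x, ‖(Δ ζ) x‖) + M ^ 2 * ((∫ x, ‖fderiv ℝ ζ x‖) +
        κ * (2 * R) * (∫ x, ‖fderiv ℝ (fderiv ℝ ζ) x‖) + (3 / 2 * κ + 8 * 64 * κ ^ 3) * (2 / R) * (∫ x, |ζ x|)))
      ≤ ‖e‖ * (t - s') * ((M * a + M ^ 2 * (a + κ * 2 * a + (3 / 2 * κ + 8 * 64 * κ ^ 3) * 2)) * V2 / R) :=
        mul_le_mul_of_nonneg_left hsum hes
    _ = ‖e‖ * (t - s') * ((M * a + M ^ 2 * (a + κ * 2 * a + (3 / 2 * κ + 8 * 64 * κ ^ 3) * 2)) * (8 * V₁) * R ^ 2) := by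
        rw [hfin]

/-- **ZB holds** (`abs_defect_le` + the Type-I bound `C/√(−s')` in the far past). -/
theorem zeroModeBumpLaw : ZeroModeBumpLaw := by
  intro C v hrate hcont hmild t ht a θ ha hθ e ε hε
  obtain ⟨K, hK0, hK⟩ := abs_defect_le hrate hcont hmild ht ha hθ
  have hC0 : 0 ≤ C := by
    by_contra hC
    push Not at hC
    have h1 := div_neg_of_neg_of_pos hC (Real.sqrt_pos.2 (neg_pos.2 ht))
    linarith [(norm_nonneg (v t 0)).trans (hrate t ht 0)]
  set V₁ : ℝ := volume.real (closedBall (0 : E3) 1) with hV₁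
  have hV₁0 : 0 ≤ V₁ := measureReal_nonneg
  -- ## the far-past time `s'`: `C‖e‖·8V₁/√(−s') ≤ ε/2`
  set A : ℝ := 2 * C * ‖e‖ * (8 * V₁) / ε with hA
  have hA0 : 0 ≤ A := by positivity
  set s' : ℝ := min (t - 1) (-(A ^ 2 + 1)) with hs'def
  have hs't : s' < t := lt_of_le_of_lt (min_le_left _ _) (by linarith)
  have hs'0 : s' < 0 := hs't.trans ht
  have hs'le : s' ≤ -(A ^ 2 + 1) := min_le_right _ _
  have hsq : A ≤ Real.sqrt (-s') := by
    have h1 : A ^ 2 ≤ -s' := by linarith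
    calc A = Real.sqrt (A ^ 2) := (Real.sqrt_sq hA0).symm
      _ ≤ Real.sqrt (-s') := Real.sqrt_le_sqrt h1
  have hsq0 : 0 < Real.sqrt (-s') := Real.sqrt_pos.2 (neg_pos.2 hs'0)
  have hfar : C / Real.sqrt (-s') * ‖e‖ * (8 * V₁) ≤ ε / 2 := by
    have h1 : C * ‖e‖ * (8 * V₁) = ε / 2 * A := by rw [hA]; field_simp
    have h2 : ε / 2 * A ≤ ε / 2 * Real.sqrt (-s') := mul_le_mul_of_nonneg_left hsq (by positivity)
    rw [div_mul_eq_mul_div, div_mul_eq_mul_div, div_le_iff₀ hsq0, h1]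
    linarith
  -- ## the radius
  set R₀ : ℝ := max 1 (2 * ‖e‖ * (t - s') * K / ε) with hR₀
  refine ⟨R₀, le_max_left _ _, fun R hR => ?_⟩
  have hR1 : 1 ≤ R := le_trans (le_max_left _ _) hR
  have hR0 : 0 < R := by linarith
  have hRK : ‖e‖ * (t - s') * (K * R ^ 2) ≤ ε / 2 * R ^ 3 := by
    have h1 : 2 * ‖e‖ * (t - s') * K / ε ≤ R := le_trans (le_max_right _ _) hR
    rw [div_le_iff₀ hε] at h1
    have h2 : 0 ≤ R ^ 2 := sq_nonneg _
    nlinarith [mul_le_mul_of_nonneg_right h1 h2]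
  obtain ⟨hθt, hsupp, h0, -, -, -⟩ := hθ R hR1
  -- ## continuity / integrability
  have hζc : Continuous (θ R) := hθt.contDiff.continuous
  have hζcs : HasCompactSupport (θ R) := hθt.hasCompactSupport
  have hvt : Continuous (v t) := continuous_slice hcont ht
  have hvs : Continuous (v s') := continuous_slice hcont hs'0
  have hint1 : Integrable (fun x => θ R x * ⟪v t x - v s' x, e⟫) :=
    (hζc.mul ((hvt.sub hvs).inner continuous_const)).integrable_of_hasCompactSupport hζcs.mul_right
  have hint2 : Integrable (fun x => θ R x * ⟪v s' x, e⟫) :=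
    (hζc.mul (hvs.inner continuous_const)).integrable_of_hasCompactSupport hζcs.mul_right
  have hsplit : ∫ x, θ R x * ⟪v t x, e⟫ = (∫ x, θ R x * ⟪v t x - v s' x, e⟫) + ∫ x, θ R x * ⟪v s' x, e⟫ := by
    rw [← integral_add hint1 hint2]
    congr 1; ext x
    rw [inner_sub_left]; ring
  -- ## the far-past term
  have hout : ∀ x, x ∉ closedBall (0 : E3) (2 * R) → x ∉ tsupport (θ R) := fun x hx h' => hx (hsupp h')
  have hMs' : ∀ y, ‖v s' y‖ ≤ C / Real.sqrt (-s') := fun y => hrate s' hs'0 y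
  have hfarR : |∫ x, θ R x * ⟪v s' x, e⟫| ≤ C / Real.sqrt (-s') * ‖e‖ * (8 * V₁) * R ^ 3 := by
    have hle : ∀ x, ‖θ R x * ⟪v s' x, e⟫‖ ≤ C / Real.sqrt (-s') * ‖e‖ := by
      intro x
      rw [norm_mul, Real.norm_eq_abs]
      have h1 : ‖⟪v s' x, e⟫‖ ≤ ‖v s' x‖ * ‖e‖ := norm_inner_le_norm _ _
      have h2 : ‖v s' x‖ * ‖e‖ ≤ C / Real.sqrt (-s') * ‖e‖ := mul_le_mul_of_nonneg_right (hMs' x) (norm_nonneg _)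
      calc |θ R x| * ‖⟪v s' x, e⟫‖ ≤ 1 * (C / Real.sqrt (-s') * ‖e‖) :=
            mul_le_mul (h0 x) (h1.trans h2) (norm_nonneg _) zero_le_one
        _ = C / Real.sqrt (-s') * ‖e‖ := one_mul _
    have hI := integral_norm_le_of_le_of_support (f := fun x => θ R x * ⟪v s' x, e⟫) (R := R)
      (A := C / Real.sqrt (-s') * ‖e‖) hle
      (fun x hx => by rw [image_eq_zero_of_notMem_tsupport (hout x hx), zero_mul])
    have hV2eq : volume.real (closedBall (0 : E3) (2 * R)) = 8 * R ^ 3 * V₁ := by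
      rw [hV₁, Measure.addHaar_real_closedBall' volume (0 : E3) (by positivity : (0 : ℝ) ≤ 2 * R),
        finrank_euclideanSpace_fin]
      ring
    calc |∫ x, θ R x * ⟪v s' x, e⟫| = ‖∫ x, θ R x * ⟪v s' x, e⟫‖ := (Real.norm_eq_abs _).symm
      _ ≤ ∫ x, ‖θ R x * ⟪v s' x, e⟫‖ := norm_integral_le_integral_norm _
      _ ≤ C / Real.sqrt (-s') * ‖e‖ * volume.real (closedBall (0 : E3) (2 * R)) := hI
      _ = C / Real.sqrt (-s') * ‖e‖ * (8 * V₁) * R ^ 3 := by rw [hV2eq]; ring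
  -- ## assemble
  have hdef := hK s' hs't R hR1 e
  have hR3 : 0 ≤ R ^ 3 := by positivity
  calc |∫ x, θ R x * ⟪v t x, e⟫|
      = |(∫ x, θ R x * ⟪v t x - v s' x, e⟫) + ∫ x, θ R x * ⟪v s' x, e⟫| := by rw [hsplit]
    _ ≤ |∫ x, θ R x * ⟪v t x - v s' x, e⟫| + |∫ x, θ R x * ⟪v s' x, e⟫| := abs_add_le _ _
    _ ≤ ε / 2 * R ^ 3 + C / Real.sqrt (-s') * ‖e‖ * (8 * V₁) * R ^ 3 := add_le_add (hdef.trans hRK) hfarR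
    _ ≤ ε / 2 * R ^ 3 + ε / 2 * R ^ 3 := by gcongr
    _ = ε * R ^ 3 := by ring

/-! ## FB — bump flux transport (STUB, M: the hand's) -/

/-- **FB — bump flux transport on a hot plane.**  If `v₂(t,·) ≡ N := v₂(t,0)` on the plane `{y₂ = 0}`, there are ABSOLUTE `μ > 0` and
`K ≥ 0` (depending on `v`, `t` only) such that for every aspect ratio `0 < λ ≤ 1/4` an admissible bump family `θ_R` (derivative constant
`a = a(λ) ≥ 0`) exists with mass `∫ θ_R ≥ μλR³` and flux defect `|∫ θ_R v₂(t) − N ∫ θ_R| ≤ K λ² R³` for all `R ≥ 1`.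
Route: product bump `ρ(x_h/R)·g(x₂/(λR))`, ONE box divergence theorem as in `…FluxTransport` (see the file header). -/
def BumpFluxTransport : Prop :=
  ∀ (C : ℝ) (v : ℝ → E3 → E3),
    HasTypeITimeDecay C v →
    ContinuousOn (uncurry v) (Iio (0 : ℝ) ×ˢ univ) →
    (∀ s t : ℝ, s < t → t < 0 → ∀ x, v t x = heatExtension (v s) (t - s) x - oseenDuhamel 1 s v v t x) →
    (∀ t < 0, VectorCalculus.IsDivFree (v t)) →
    ∀ t : ℝ, t < 0 → (∀ y : E3, y 2 = 0 → v t y 2 = v t 0 2) →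
      ∃ μ K : ℝ, 0 < μ ∧ 0 ≤ K ∧ ∀ lam : ℝ, 0 < lam → lam ≤ 1 / 4 →
        ∃ (a : ℝ) (θ : ℝ → E3 → ℝ), 0 ≤ a ∧ IsBumpFamily a θ ∧
          (∀ R : ℝ, 1 ≤ R → μ * lam * R ^ 3 ≤ ∫ x, θ R x) ∧
          (∀ R : ℝ, 1 ≤ R → |(∫ x, θ R x * v t x 2) - v t 0 2 * ∫ x, θ R x| ≤ K * lam ^ 2 * R ^ 3)

/-! ### FB.1  One-dimensional cut-offs, the profile `Θ_λ` and the bump family `θ_R = Θ_λ(·/R)` -/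

/-- `χ_ρ := cutoff (E := ℝ) ρ` on the line: `= 1` on `|s| ≤ ρ`, `= 0` on `|s| ≥ 2ρ`, values in `[0,1]`, smooth. -/
abbrev chi (ρ : ℝ) : ℝ → ℝ := cutoff (E := ℝ) ρ

theorem chi_eq_one {ρ s : ℝ} (hρ : 0 < ρ) (h : |s| ≤ ρ) : chi ρ s = 1 :=
  cutoff_eq_one hρ (by simpa [Real.norm_eq_abs] using h)

theorem chi_eq_zero {ρ s : ℝ} (hρ : 0 < ρ) (h : 2 * ρ ≤ |s|) : chi ρ s = 0 :=
  cutoff_eq_zero hρ (by simpa [Real.norm_eq_abs] using h)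

theorem chi_nonneg (ρ s : ℝ) : 0 ≤ chi ρ s := cutoff_nonneg ρ s

theorem chi_le_one (ρ s : ℝ) : chi ρ s ≤ 1 := cutoff_le_one ρ s

theorem abs_chi_le_one (ρ s : ℝ) : |chi ρ s| ≤ 1 := by
  rw [abs_of_nonneg (chi_nonneg ρ s)]; exact chi_le_one ρ s

theorem contDiff_chi (ρ : ℝ) {n : ℕ∞} : ContDiff ℝ n (chi ρ) := contDiff_cutoff ρ

theorem continuous_chi (ρ : ℝ) : Continuous (chi ρ) := (contDiff_chi ρ (n := 0)).continuous

theorem differentiable_chi (ρ : ℝ) : Differentiable ℝ (chi ρ) := (contDiff_chi ρ (n := 1)).differentiable (by simp)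

/-- The unscaled profile `Θ_λ(y) = χ_{1/2}(y₀)·χ_{1/2}(y₁)·χ_λ(y₂ − 2λ)`. -/
def prof (lam : ℝ) (y : E3) : ℝ := chi (1 / 2) (y 0) * chi (1 / 2) (y 1) * chi lam (y 2 - 2 * lam)

/-- The bump family `θ_R(x) = Θ_λ(R⁻¹ • x)`. -/
def bump (lam R : ℝ) (x : E3) : ℝ := prof lam (R⁻¹ • x)

theorem bump_apply (lam R : ℝ) (x : E3) :
    bump lam R x = chi (1 / 2) (R⁻¹ * x 0) * chi (1 / 2) (R⁻¹ * x 1) * chi lam (R⁻¹ * x 2 - 2 * lam) := by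
  simp only [bump, prof, PiLp.smul_apply, smul_eq_mul]

theorem prof_nonneg (lam : ℝ) (y : E3) : 0 ≤ prof lam y :=
  mul_nonneg (mul_nonneg (chi_nonneg _ _) (chi_nonneg _ _)) (chi_nonneg _ _)

theorem prof_le_one (lam : ℝ) (y : E3) : prof lam y ≤ 1 :=
  mul_le_one₀ (mul_le_one₀ (chi_le_one _ _) (chi_nonneg _ _) (chi_le_one _ _)) (chi_nonneg _ _) (chi_le_one _ _)

theorem bump_nonneg (lam R : ℝ) (x : E3) : 0 ≤ bump lam R x := prof_nonneg _ _

theorem bump_le_one (lam R : ℝ) (x : E3) : bump lam R x ≤ 1 := prof_le_one _ _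

theorem abs_bump_le_one (lam R : ℝ) (x : E3) : |bump lam R x| ≤ 1 := by
  rw [abs_of_nonneg (bump_nonneg _ _ _)]; exact bump_le_one _ _ _

theorem contDiff_prof (lam : ℝ) {n : ℕ∞} : ContDiff ℝ n (prof lam) := by
  have h0 : ContDiff ℝ n (fun y : E3 => y 0) := (EuclideanSpace.proj (𝕜 := ℝ) (0 : Fin 3)).contDiff
  have h1 : ContDiff ℝ n (fun y : E3 => y 1) := (EuclideanSpace.proj (𝕜 := ℝ) (1 : Fin 3)).contDiff
  have h2 : ContDiff ℝ n (fun y : E3 => y 2 - 2 * lam) :=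
    (EuclideanSpace.proj (𝕜 := ℝ) (2 : Fin 3)).contDiff.sub contDiff_const
  unfold prof
  exact (((contDiff_chi _).comp h0).mul ((contDiff_chi _).comp h1)).mul ((contDiff_chi _).comp h2)

theorem contDiff_bump (lam R : ℝ) {n : ℕ∞} : ContDiff ℝ n (bump lam R) := by
  unfold bump
  exact (contDiff_prof lam).comp (contDiff_id.const_smul R⁻¹)

theorem continuous_bump (lam R : ℝ) : Continuous (bump lam R) := (contDiff_bump lam R (n := 0)).continuous

/-- Off the slab `{|y₀| < 1, |y₁| < 1, 0 < y₂ < 4λ}` the profile vanishes. -/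
theorem prof_eq_zero_of {lam : ℝ} (hlam : 0 < lam) {y : E3}
    (hy : 1 ≤ |y 0| ∨ 1 ≤ |y 1| ∨ y 2 ≤ 0 ∨ 4 * lam ≤ y 2) : prof lam y = 0 := by
  unfold prof
  rcases hy with h | h | h | h
  · rw [chi_eq_zero (by norm_num : (0:ℝ) < 1 / 2) (by linarith)]; ring
  · rw [chi_eq_zero (ρ := 1 / 2) (by norm_num) (by linarith : 2 * (1 / 2 : ℝ) ≤ |y 1|)]; ring
  · have : 2 * lam ≤ |y 2 - 2 * lam| := by rw [abs_of_nonpos (by linarith)]; linarith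
    rw [chi_eq_zero hlam this]; ring
  · have : 2 * lam ≤ |y 2 - 2 * lam| := by rw [abs_of_nonneg (by linarith)]; linarith
    rw [chi_eq_zero hlam this]; ring

theorem norm_sq_eq (y : E3) : ‖y‖ ^ 2 = y 0 ^ 2 + y 1 ^ 2 + y 2 ^ 2 := by
  rw [EuclideanSpace.norm_eq, Real.sq_sqrt (by positivity), Fin.sum_univ_three]
  simp [Real.norm_eq_abs, sq_abs]

/-- Where the profile is non-zero, `‖y‖ < 2` (for `λ ≤ 1/4`). -/
theorem norm_lt_two_of_prof_ne_zero {lam : ℝ} (hlam : 0 < lam) (hlam4 : lam ≤ 1 / 4) {y : E3}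
    (hy : prof lam y ≠ 0) : ‖y‖ < 2 := by
  have h0 : |y 0| < 1 := by
    by_contra h; exact hy (prof_eq_zero_of hlam (Or.inl (not_lt.1 h)))
  have h1 : |y 1| < 1 := by
    by_contra h; exact hy (prof_eq_zero_of hlam (Or.inr (Or.inl (not_lt.1 h))))
  have h2 : 0 < y 2 := by
    by_contra h; exact hy (prof_eq_zero_of hlam (Or.inr (Or.inr (Or.inl (not_lt.1 h)))))
  have h3 : y 2 < 4 * lam := by
    by_contra h; exact hy (prof_eq_zero_of hlam (Or.inr (Or.inr (Or.inr (not_lt.1 h)))))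
  have hsq : ‖y‖ ^ 2 < 2 ^ 2 := by
    rw [norm_sq_eq]
    have a0 : y 0 ^ 2 < 1 := by
      have := abs_lt.1 h0; nlinarith
    have a1 : y 1 ^ 2 < 1 := by
      have := abs_lt.1 h1; nlinarith
    have a2 : y 2 ^ 2 ≤ 1 := by nlinarith
    linarith
  exact (pow_lt_pow_iff_left₀ (norm_nonneg _) (by norm_num) (by norm_num)).1 hsq

theorem hasCompactSupport_prof {lam : ℝ} (hlam : 0 < lam) (hlam4 : lam ≤ 1 / 4) :
    HasCompactSupport (prof lam) := by
  refine HasCompactSupport.intro (isCompact_closedBall (0 : E3) 2) fun y hy => ?_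
  by_contra h
  exact hy (mem_closedBall_zero_iff.2 (norm_lt_two_of_prof_ne_zero hlam hlam4 h).le)

/-- Where the bump is non-zero, `‖x‖ < 2R`. -/
theorem norm_lt_of_bump_ne_zero {lam R : ℝ} (hlam : 0 < lam) (hlam4 : lam ≤ 1 / 4) (hR : 0 < R) {x : E3}
    (hx : bump lam R x ≠ 0) : ‖x‖ < 2 * R := by
  have h := norm_lt_two_of_prof_ne_zero hlam hlam4 (y := R⁻¹ • x) hx
  rw [norm_smul, norm_inv, Real.norm_of_nonneg hR.le] at h
  rwa [inv_mul_lt_iff₀ hR, mul_comm] at h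

theorem bump_eq_zero_of_norm_ge {lam R : ℝ} (hlam : 0 < lam) (hlam4 : lam ≤ 1 / 4) (hR : 0 < R) {x : E3}
    (hx : 2 * R ≤ ‖x‖) : bump lam R x = 0 := by
  by_contra h; exact absurd (norm_lt_of_bump_ne_zero hlam hlam4 hR h) (not_lt.2 hx)

theorem hasCompactSupport_bump {lam R : ℝ} (hlam : 0 < lam) (hlam4 : lam ≤ 1 / 4) (hR : 0 < R) :
    HasCompactSupport (bump lam R) :=
  HasCompactSupport.intro (isCompact_closedBall (0 : E3) (2 * R)) fun x hx =>
    bump_eq_zero_of_norm_ge hlam hlam4 hR (by rw [mem_closedBall_zero_iff, not_le] at hx; exact hx.le)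

theorem tsupport_bump_subset {lam R : ℝ} (hlam : 0 < lam) (hlam4 : lam ≤ 1 / 4) (hR : 0 < R) :
    tsupport (bump lam R) ⊆ closedBall (0 : E3) (2 * R) := by
  refine closure_minimal ?_ isClosed_closedBall
  intro x hx
  rw [mem_closedBall_zero_iff]
  exact (norm_lt_of_bump_ne_zero hlam hlam4 hR hx).le

theorem isTestFunctionOn_bump {lam R : ℝ} (hlam : 0 < lam) (hlam4 : lam ≤ 1 / 4) (hR : 0 < R) :
    FunctionSpaces.IsTestFunctionOn (⊤ : TopologicalSpace.Opens E3) (bump lam R) where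
  contDiff := contDiff_bump lam R
  hasCompactSupport := hasCompactSupport_bump hlam hlam4 hR
  tsupport_subset := by simp

/-- `|Δf| ≤ 3‖D²f‖` on `ℝ³`. -/
theorem abs_laplacian_le {f : E3 → ℝ} (hf : ContDiff ℝ 2 f) (y : E3) :
    |Δ f y| ≤ 3 * ‖fderiv ℝ (fderiv ℝ f) y‖ := by
  have hd : DifferentiableAt ℝ (fderiv ℝ f) y :=
    ((hf.fderiv_right (m := 1) le_rfl).differentiable one_ne_zero).differentiableAt
  set b := EuclideanSpace.basisFun (Fin 3) ℝ with hb
  rw [laplacian_eq_sum_fderiv_fderiv_apply b hf y]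
  have hbn : ∀ i, ‖b i‖ = 1 := fun i => b.orthonormal.1 i
  have hterm : ∀ i, |fderiv ℝ (fun z => fderiv ℝ f z (b i)) y (b i)| ≤ ‖fderiv ℝ (fderiv ℝ f) y‖ := by
    intro i
    have e : fderiv ℝ (fun z => fderiv ℝ f z (b i)) y (b i) = fderiv ℝ (fderiv ℝ f) y (b i) (b i) := by
      rw [fderiv_clm_apply hd (differentiableAt_const _)]; simp
    rw [e]
    calc |(fderiv ℝ (fderiv ℝ f) y (b i)) (b i)| = ‖(fderiv ℝ (fderiv ℝ f) y (b i)) (b i)‖ := (Real.norm_eq_abs _).symm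
      _ ≤ ‖fderiv ℝ (fderiv ℝ f) y (b i)‖ * ‖b i‖ := ContinuousLinearMap.le_opNorm _ _
      _ ≤ ‖fderiv ℝ (fderiv ℝ f) y‖ * ‖b i‖ * ‖b i‖ := by gcongr; exact ContinuousLinearMap.le_opNorm _ _
      _ = ‖fderiv ℝ (fderiv ℝ f) y‖ := by rw [hbn i]; ring
  rw [Fin.sum_univ_three]
  have h0 := hterm 0; have h1 := hterm 1; have h2 := hterm 2
  calc _ ≤ |fderiv ℝ (fun z => fderiv ℝ f z (b 0)) y (b 0)| + |fderiv ℝ (fun z => fderiv ℝ f z (b 1)) y (b 1)|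
        + |fderiv ℝ (fun z => fderiv ℝ f z (b 2)) y (b 2)| := abs_add_three _ _ _
    _ ≤ _ := by linarith

/-- **Uniform derivative bounds for the profile** (continuity + compact support). -/
theorem exists_bounds_prof {lam : ℝ} (hlam : 0 < lam) (hlam4 : lam ≤ 1 / 4) :
    ∃ A : ℝ, 0 ≤ A ∧ (∀ y, ‖fderiv ℝ (prof lam) y‖ ≤ A) ∧ (∀ y, ‖fderiv ℝ (fderiv ℝ (prof lam)) y‖ ≤ A) := by
  have hcd : ContDiff ℝ 2 (prof lam) := contDiff_prof lam (n := 2)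
  have hcs : HasCompactSupport (prof lam) := hasCompactSupport_prof hlam hlam4
  obtain ⟨A₁, hA₁⟩ := (hcd.continuous_fderiv (by norm_num)).bounded_above_of_compact_support
    (hcs.fderiv (𝕜 := ℝ))
  obtain ⟨A₂, hA₂⟩ := ((hcd.fderiv_right (m := 1) le_rfl).continuous_fderiv one_ne_zero).bounded_above_of_compact_support
    ((hcs.fderiv (𝕜 := ℝ)).fderiv (𝕜 := ℝ))
  refine ⟨max (max A₁ A₂) 0, le_max_right _ _, fun y => (hA₁ y).trans ((le_max_left _ _).trans (le_max_left _ _)),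
    fun y => (hA₂ y).trans ((le_max_right _ _).trans (le_max_left _ _))⟩

/-- Scaling of the first derivative. -/
theorem fderiv_bump (lam R : ℝ) (x : E3) :
    fderiv ℝ (bump lam R) x = R⁻¹ • fderiv ℝ (prof lam) (R⁻¹ • x) :=
  fderiv_comp_smul (f := prof lam) (x := x) R⁻¹

/-- Scaling of the second derivative. -/
theorem fderiv_fderiv_bump (lam R : ℝ) (x : E3) :
    fderiv ℝ (fderiv ℝ (bump lam R)) x = R⁻¹ • (R⁻¹ • fderiv ℝ (fderiv ℝ (prof lam)) (R⁻¹ • x)) := by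
  have hd : ∀ y, DifferentiableAt ℝ (fderiv ℝ (prof lam)) y := fun y =>
    (((contDiff_prof lam (n := 2)).fderiv_right (m := 1) le_rfl).differentiable one_ne_zero) y
  have h1 : fderiv ℝ (bump lam R) = fun x => (R⁻¹ • fderiv ℝ (prof lam)) (R⁻¹ • x) :=
    funext fun x => fderiv_bump lam R x
  rw [h1, fderiv_comp_smul (𝕜 := ℝ) (f := R⁻¹ • fderiv ℝ (prof lam)) R⁻¹, fderiv_const_smul (hd _)]

/-- **The bump family is admissible**: `IsBumpFamily a (bump λ)` for a suitable `a = a(λ)`. -/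
theorem isBumpFamily_bump {lam : ℝ} (hlam : 0 < lam) (hlam4 : lam ≤ 1 / 4) :
    ∃ a : ℝ, 0 ≤ a ∧ IsBumpFamily a (bump lam) := by
  obtain ⟨A, hA0, hA1, hA2⟩ := exists_bounds_prof hlam hlam4
  refine ⟨3 * A, by positivity, fun R hR => ?_⟩
  have hR0 : 0 < R := by linarith
  have hRi : 0 ≤ R⁻¹ := inv_nonneg.2 hR0.le
  refine ⟨isTestFunctionOn_bump hlam hlam4 hR0, tsupport_bump_subset hlam hlam4 hR0, abs_bump_le_one lam R,
    fun x => ?_, fun x => ?_, fun x => ?_⟩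
  · rw [fderiv_bump, norm_smul, Real.norm_of_nonneg hRi]
    calc R⁻¹ * ‖fderiv ℝ (prof lam) (R⁻¹ • x)‖ ≤ R⁻¹ * A := by gcongr; exact hA1 _
      _ ≤ 3 * A / R := by rw [div_eq_inv_mul]; nlinarith
  · rw [fderiv_fderiv_bump]
    refine ContinuousLinearMap.opNorm_le_bound _ (by positivity) fun v => ?_
    rw [ContinuousLinearMap.smul_apply, ContinuousLinearMap.smul_apply, norm_smul, norm_smul, Real.norm_of_nonneg hRi]
    calc R⁻¹ * (R⁻¹ * ‖fderiv ℝ (fderiv ℝ (prof lam)) (R⁻¹ • x) v‖) ≤ R⁻¹ * (R⁻¹ * (A * ‖v‖)) := by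
          gcongr
          exact (ContinuousLinearMap.le_opNorm _ _).trans (mul_le_mul_of_nonneg_right (hA2 _) (norm_nonneg _))
      _ ≤ 3 * A / R ^ 2 * ‖v‖ := by
          rw [show R⁻¹ * (R⁻¹ * (A * ‖v‖)) = A / R ^ 2 * ‖v‖ by field_simp]
          gcongr; linarith
  · have hsc := laplacian_comp_smul_eq (prof lam) R⁻¹ x
    have hb : (Δ (bump lam R)) x = R⁻¹ ^ 2 * (Δ (prof lam)) (R⁻¹ • x) := by
      rw [show bump lam R = fun y => prof lam (R⁻¹ • y) from rfl, hsc, smul_eq_mul]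
    rw [hb, abs_mul, abs_of_nonneg (by positivity)]
    have h3 := abs_laplacian_le (contDiff_prof lam (n := 2)) (R⁻¹ • x)
    calc R⁻¹ ^ 2 * |Δ (prof lam) (R⁻¹ • x)| ≤ R⁻¹ ^ 2 * (3 * ‖fderiv ℝ (fderiv ℝ (prof lam)) (R⁻¹ • x)‖) := by gcongr
      _ ≤ R⁻¹ ^ 2 * (3 * A) := by gcongr; exact hA2 _
      _ = 3 * A / R ^ 2 := by field_simp


/-! ### FB.2  Mass of the bump: `∫ θ_R ≥ 2λR³` -/

theorem bump_eq_one_of {lam R : ℝ} (hlam : 0 < lam) (hR : 0 < R) {x : E3}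
    (h0 : |x 0| ≤ R / 2) (h1 : |x 1| ≤ R / 2) (h2 : lam * R ≤ x 2) (h3 : x 2 ≤ 3 * (lam * R)) :
    bump lam R x = 1 := by
  rw [bump_apply]
  have hRi : 0 < R⁻¹ := inv_pos.2 hR
  have e0 : chi (1 / 2) (R⁻¹ * x 0) = 1 := by
    refine chi_eq_one (by norm_num) ?_
    rw [abs_mul, abs_of_pos hRi, ← div_eq_inv_mul, div_le_iff₀ hR]; linarith
  have e1 : chi (1 / 2) (R⁻¹ * x 1) = 1 := by
    refine chi_eq_one (by norm_num) ?_
    rw [abs_mul, abs_of_pos hRi, ← div_eq_inv_mul, div_le_iff₀ hR]; linarith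
  have e2 : chi lam (R⁻¹ * x 2 - 2 * lam) = 1 := by
    refine chi_eq_one hlam (abs_le.2 ⟨?_, ?_⟩)
    · have : lam ≤ R⁻¹ * x 2 := by rw [le_inv_mul_iff₀ hR]; linarith
      linarith
    · have : R⁻¹ * x 2 ≤ 3 * lam := by rw [inv_mul_le_iff₀ hR]; linarith
      linarith
  rw [e0, e1, e2]; ring

theorem innerBox_eq_preimage (R r : ℝ) :
    {x : E3 | |x 0| ≤ R / 2 ∧ |x 1| ≤ R / 2 ∧ r ≤ x 2 ∧ x 2 ≤ 3 * r} =
      (WithLp.ofLp : E3 → (Fin 3 → ℝ)) ⁻¹' Icc (![-(R / 2), -(R / 2), r] : Fin 3 → ℝ) ![R / 2, R / 2, 3 * r] := by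
  ext x
  simp only [mem_setOf_eq, mem_preimage, mem_Icc, Pi.le_def]
  constructor
  · rintro ⟨h0, h1, h2, h3⟩
    obtain ⟨h0a, h0b⟩ := abs_le.1 h0
    obtain ⟨h1a, h1b⟩ := abs_le.1 h1
    refine ⟨fun i => ?_, fun i => ?_⟩ <;> fin_cases i <;> simp <;> linarith
  · rintro ⟨hlo, hhi⟩
    have h0a := hlo 0; have h0b := hhi 0; have h1a := hlo 1; have h1b := hhi 1; have h2a := hlo 2; have h2b := hhi 2
    simp at h0a h0b h1a h1b h2a h2b
    exact ⟨abs_le.2 ⟨by linarith, by linarith⟩, abs_le.2 ⟨by linarith, by linarith⟩, by linarith, by linarith⟩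

theorem volume_innerBox {R r : ℝ} (hR : 0 ≤ R) (hr : 0 ≤ r) :
    volume {x : E3 | |x 0| ≤ R / 2 ∧ |x 1| ≤ R / 2 ∧ r ≤ x 2 ∧ x 2 ≤ 3 * r} = ENNReal.ofReal (2 * R ^ 2 * r) := by
  rw [innerBox_eq_preimage, (PiLp.volume_preserving_ofLp (Fin 3)).measure_preimage_emb measurableEmbedding_ofLp,
    Real.volume_Icc_pi, Fin.prod_univ_three]
  simp only [Matrix.cons_val_zero, Matrix.cons_val_one, Matrix.cons_val_two, Matrix.head_cons, Matrix.tail_cons,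
    sub_neg_eq_add]
  rw [← ENNReal.ofReal_mul (by linarith), ← ENNReal.ofReal_mul (by positivity)]
  congr 1
  ring

theorem measurableSet_innerBox (R r : ℝ) :
    MeasurableSet {x : E3 | |x 0| ≤ R / 2 ∧ |x 1| ≤ R / 2 ∧ r ≤ x 2 ∧ x 2 ≤ 3 * r} := by
  rw [innerBox_eq_preimage]
  exact measurableSet_Icc.preimage measurableEmbedding_ofLp.measurable

theorem integrable_bump {lam R : ℝ} (hlam : 0 < lam) (hlam4 : lam ≤ 1 / 4) (hR : 0 < R) :
    Integrable (bump lam R) :=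
  (continuous_bump lam R).integrable_of_hasCompactSupport (hasCompactSupport_bump hlam hlam4 hR)

/-- **Mass**: `2λR³ ≤ ∫ θ_R`. -/
theorem mass_bump {lam R : ℝ} (hlam : 0 < lam) (hlam4 : lam ≤ 1 / 4) (hR : 1 ≤ R) :
    2 * lam * R ^ 3 ≤ ∫ x, bump lam R x := by
  have hR0 : 0 < R := by linarith
  have hlR : 0 ≤ lam * R := by positivity
  set B := {x : E3 | |x 0| ≤ R / 2 ∧ |x 1| ≤ R / 2 ∧ lam * R ≤ x 2 ∧ x 2 ≤ 3 * (lam * R)} with hB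
  have hBm : MeasurableSet B := measurableSet_innerBox R (lam * R)
  have h1 : ∫ x in B, bump lam R x ≤ ∫ x, bump lam R x :=
    setIntegral_le_integral (integrable_bump hlam hlam4 hR0) (Eventually.of_forall fun x => bump_nonneg lam R x)
  have h2 : ∫ x in B, bump lam R x = ∫ x in B, (1 : ℝ) :=
    setIntegral_congr_fun hBm fun x hx => bump_eq_one_of hlam hR0 hx.1 hx.2.1 hx.2.2.1 hx.2.2.2
  have h3 : ∫ x in B, (1 : ℝ) = volume.real B := by simp
  have h4 : volume.real B = 2 * R ^ 2 * (lam * R) := by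
    rw [measureReal_def, hB, volume_innerBox hR0.le hlR, ENNReal.toReal_ofReal (by positivity)]
  calc 2 * lam * R ^ 3 = 2 * R ^ 2 * (lam * R) := by ring
    _ = ∫ x in B, bump lam R x := by rw [h2, h3, h4]
    _ ≤ _ := h1

/-! ### FB.3  The vertical profile and its tail primitive `H(z) = ∫_z^{4λR} χ_λ(s/R − 2λ) ds` -/

/-- `κ(s) = χ_λ(s/R − 2λ)`. -/
def kapR (lam R : ℝ) (s : ℝ) : ℝ := chi lam (R⁻¹ * s - 2 * lam)

theorem continuous_kapR (lam R : ℝ) : Continuous (kapR lam R) :=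
  (continuous_chi lam).comp ((continuous_const.mul continuous_id).sub continuous_const)

/-- `H(z) = ∫_z^{4λR} κ`. -/
def Hfun (lam R : ℝ) (z : ℝ) : ℝ := ∫ s in z..(4 * lam * R), kapR lam R s

theorem hasDerivAt_Hfun (lam R z : ℝ) : HasDerivAt (Hfun lam R) (-kapR lam R z) z := by
  have hc := continuous_kapR lam R
  have h1 : HasDerivAt (fun w => ∫ s in (4 * lam * R)..w, kapR lam R s) (kapR lam R z) z :=
    intervalIntegral.integral_hasDerivAt_right (hc.intervalIntegrable _ _) (hc.stronglyMeasurableAtFilter _ _)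
      hc.continuousAt
  have h2 : Hfun lam R = fun w => -∫ s in (4 * lam * R)..w, kapR lam R s := by
    funext w; rw [Hfun, intervalIntegral.integral_symm]
  rw [h2]; exact h1.neg

theorem continuous_Hfun (lam R : ℝ) : Continuous (Hfun lam R) :=
  continuous_iff_continuousAt.2 fun z => (hasDerivAt_Hfun lam R z).continuousAt

theorem Hfun_top (lam R : ℝ) : Hfun lam R (4 * lam * R) = 0 := intervalIntegral.integral_same

theorem Hfun_nonneg {lam R z : ℝ} (hz : z ≤ 4 * lam * R) : 0 ≤ Hfun lam R z :=
  intervalIntegral.integral_nonneg hz fun s _ => chi_nonneg _ _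

theorem Hfun_le {lam R z : ℝ} (hz0 : 0 ≤ z) (hz : z ≤ 4 * lam * R) : Hfun lam R z ≤ 4 * lam * R := by
  have h := intervalIntegral.norm_integral_le_of_norm_le_const (a := z) (b := 4 * lam * R) (C := 1)
    (f := kapR lam R) (fun s _ => by rw [Real.norm_eq_abs]; exact abs_chi_le_one _ _)
  rw [Real.norm_eq_abs, abs_of_nonneg (by linarith : (0:ℝ) ≤ 4 * lam * R - z)] at h
  have := le_abs_self (∫ s in z..(4 * lam * R), kapR lam R s)
  show (∫ s in z..(4 * lam * R), kapR lam R s) ≤ 4 * lam * R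
  linarith

theorem abs_Hfun_le {lam R z : ℝ} (hz0 : 0 ≤ z) (hz : z ≤ 4 * lam * R) : |Hfun lam R z| ≤ 4 * lam * R := by
  rw [abs_of_nonneg (Hfun_nonneg hz)]; exact Hfun_le hz0 hz

/-- A global bound for `|χ'_{1/2}|`. -/
theorem exists_deriv_chi_bound : ∃ D : ℝ, 0 ≤ D ∧ ∀ s, |deriv (chi (1 / 2 : ℝ)) s| ≤ D := by
  have hc : Continuous (deriv (chi (1 / 2 : ℝ))) := (contDiff_chi (1 / 2) (n := 1)).continuous_deriv le_rfl
  have hs : HasCompactSupport (deriv (chi (1 / 2 : ℝ))) :=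
    (hasCompactSupport_cutoff (E := ℝ) (by norm_num : (0:ℝ) < 1 / 2)).deriv
  obtain ⟨D, hD⟩ := hc.bounded_above_of_compact_support hs
  exact ⟨max D 0, le_max_right _ _, fun s => by rw [← Real.norm_eq_abs]; exact (hD s).trans (le_max_left _ _)⟩

/-- Off the flat box `{|x₀| ≤ R, |x₁| ≤ R, 0 ≤ x₂ ≤ 4λR}` the bump vanishes. -/
theorem bump_eq_zero_off_box {lam R : ℝ} (hlam : 0 < lam) (hR : 0 < R) {x : E3}
    (hx : x ∉ {x : E3 | |x 0| ≤ R ∧ |x 1| ≤ R ∧ 0 ≤ x 2 ∧ x 2 ≤ 4 * lam * R}) : bump lam R x = 0 := by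
  rw [bump_apply]
  have hRi : 0 < R⁻¹ := inv_pos.2 hR
  simp only [mem_setOf_eq, not_and_or, not_le] at hx
  rcases hx with h | h | h | h
  · have : 2 * (1 / 2 : ℝ) ≤ |R⁻¹ * x 0| := by
      rw [abs_mul, abs_of_pos hRi, ← div_eq_inv_mul, le_div_iff₀ hR]; linarith
    rw [chi_eq_zero (by norm_num) this]; ring
  · have : 2 * (1 / 2 : ℝ) ≤ |R⁻¹ * x 1| := by
      rw [abs_mul, abs_of_pos hRi, ← div_eq_inv_mul, le_div_iff₀ hR]; linarith
    rw [chi_eq_zero (by norm_num) this]; ring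
  · have h' : R⁻¹ * x 2 < 0 := mul_neg_of_pos_of_neg hRi h
    have : 2 * lam ≤ |R⁻¹ * x 2 - 2 * lam| := by rw [abs_of_neg (by linarith)]; linarith
    rw [chi_eq_zero hlam this]; ring
  · have h' : 4 * lam < R⁻¹ * x 2 := by rw [lt_inv_mul_iff₀ hR]; linarith
    have : 2 * lam ≤ |R⁻¹ * x 2 - 2 * lam| := by rw [abs_of_pos (by linarith)]; linarith
    rw [chi_eq_zero hlam this]; ring

/-! ### FB.4  Flux transport for the bump (two applications of the divergence theorem) -/

/-- **Flux defect of the bump on a hot plane**: `|∫ θ_R v₂(t) − N ∫ θ_R| ≤ 128·D·(C/√(−t))·λ²R³`. -/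
theorem flux_bump {C : ℝ} {v : ℝ → E3 → E3} (hT : HasTypeITimeDecay C v)
    (hcont : ContinuousOn (uncurry v) (Iio (0:ℝ) ×ˢ univ))
    (hmild : ∀ s t : ℝ, s < t → t < 0 → ∀ x, v t x = heatExtension (v s) (t - s) x - oseenDuhamel 1 s v v t x)
    (hdiv : ∀ t < 0, VectorCalculus.IsDivFree (v t)) {t : ℝ} (ht : t < 0)
    (hplane : ∀ y : E3, y 2 = 0 → v t y 2 = v t 0 2) {D : ℝ} (hD0 : 0 ≤ D)
    (hD : ∀ s, |deriv (chi (1 / 2 : ℝ)) s| ≤ D)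
    {lam R : ℝ} (hlam : 0 < lam) (hlam4 : lam ≤ 1 / 4) (hR : 1 ≤ R) :
    |(∫ x, bump lam R x * v t x 2) - v t 0 2 * ∫ x, bump lam R x| ≤
      (128 * D * (C / Real.sqrt (-t))) * lam ^ 2 * R ^ 3 := by
  -- ## the slice
  set u : E3 → E3 := v t with hu
  set N : ℝ := v t 0 2 with hN
  set B : ℝ := C / Real.sqrt (-t) with hB
  have hBd : ∀ x, ‖u x‖ ≤ B := fun x => hT t ht x
  have hB0 : 0 ≤ B := (norm_nonneg _).trans (hBd 0)
  have hA : AnalyticOnNhd ℝ u univ := typeI_mild_slice_analytic C v hT hcont hmild t ht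
  have hud : Differentiable ℝ u := fun x => (hA x (mem_univ x)).differentiableAt
  have huc : Continuous u := hud.continuous
  have hR0 : 0 < R := by linarith
  have hRi : 0 < R⁻¹ := inv_pos.2 hR0
  have hlR : 0 < lam * R := mul_pos hlam hR0
  set T : ℝ := 4 * lam * R with hT4
  have hT0 : 0 < T := by positivity
  -- ## coordinates (as in `…FluxTransport`)
  set eL : E3 ≃L[ℝ] (Fin 3 → ℝ) := EuclideanSpace.equiv (Fin 3) ℝ with heL
  set g : (Fin 3 → ℝ) → (Fin 3 → ℝ) := fun p => eL (u (eL.symm p)) with hg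
  set Dg : (Fin 3 → ℝ) → (Fin 3 → ℝ) →L[ℝ] (Fin 3 → ℝ) := fun p =>
    (eL : E3 →L[ℝ] (Fin 3 → ℝ)).comp
      ((fderiv ℝ u (eL.symm p)).comp (eL.symm : (Fin 3 → ℝ) →L[ℝ] E3)) with hDg
  have hgd : ∀ p, HasFDerivAt g (Dg p) p := by
    intro p
    have h1 : HasFDerivAt (fun q => u (eL.symm q))
        ((fderiv ℝ u (eL.symm p)).comp (eL.symm : (Fin 3 → ℝ) →L[ℝ] E3)) p :=
      (hud _).hasFDerivAt.comp p eL.symm.hasFDerivAt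
    exact eL.hasFDerivAt.comp p h1
  have hg_apply : ∀ p j, g p j = u (WithLp.toLp 2 p) j := fun p j => rfl
  have hDg_apply : ∀ p i j, Dg p (Pi.single i 1) j = fderiv ℝ u (WithLp.toLp 2 p) (EuclideanSpace.single i 1) j := by
    intro p i j; rfl
  have hgc : Continuous g := eL.continuous.comp (huc.comp eL.symm.continuous)
  have hdiv0 : ∀ p, Dg p (Pi.single 0 1) 0 + Dg p (Pi.single 1 1) 1 + Dg p (Pi.single 2 1) 2 = 0 := by
    intro p
    rw [hDg_apply, hDg_apply, hDg_apply, ← divergence_eq_sum_three]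
    exact hdiv t ht _
  -- ## the weight `Ψ(p) = χ(p₀/R) χ(p₁/R) H(p₂)` and its derivative
  set π : Fin 3 → (Fin 3 → ℝ) →L[ℝ] ℝ := fun i => ContinuousLinearMap.proj i with hπ
  set a : (Fin 3 → ℝ) → ℝ := fun p => chi (1 / 2) (R⁻¹ * p 0) with ha
  set b : (Fin 3 → ℝ) → ℝ := fun p => chi (1 / 2) (R⁻¹ * p 1) with hb
  set Hc : (Fin 3 → ℝ) → ℝ := fun p => Hfun lam R (p 2) with hHc
  set d : (Fin 3 → ℝ) → Fin 3 → ℝ := fun p i => deriv (chi (1 / 2 : ℝ)) (R⁻¹ * p i) with hd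
  set Da : (Fin 3 → ℝ) → (Fin 3 → ℝ) →L[ℝ] ℝ := fun p => d p 0 • (R⁻¹ • π 0) with hDa
  set Db : (Fin 3 → ℝ) → (Fin 3 → ℝ) →L[ℝ] ℝ := fun p => d p 1 • (R⁻¹ • π 1) with hDb
  set DH : (Fin 3 → ℝ) → (Fin 3 → ℝ) →L[ℝ] ℝ := fun p => (-kapR lam R (p 2)) • π 2 with hDH
  have hlin : ∀ (i : Fin 3) (p : Fin 3 → ℝ), HasFDerivAt (fun q : Fin 3 → ℝ => R⁻¹ * q i) (R⁻¹ • π i) p :=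
    fun i p => (hasFDerivAt_apply (𝕜 := ℝ) i p).const_mul R⁻¹
  have had : ∀ p, HasFDerivAt a (Da p) p := fun p => by
    have h := HasDerivAt.comp_hasFDerivAt p ((differentiable_chi (1 / 2 : ℝ)) (R⁻¹ * p 0)).hasDerivAt (hlin 0 p)
    exact h
  have hbd : ∀ p, HasFDerivAt b (Db p) p := fun p => by
    have h := HasDerivAt.comp_hasFDerivAt p ((differentiable_chi (1 / 2 : ℝ)) (R⁻¹ * p 1)).hasDerivAt (hlin 1 p)
    exact h
  have hHd : ∀ p, HasFDerivAt Hc (DH p) p := fun p => by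
    have h := HasDerivAt.comp_hasFDerivAt p (hasDerivAt_Hfun lam R (p 2)) (hasFDerivAt_apply (𝕜 := ℝ) 2 p)
    exact h
  set Ψ : (Fin 3 → ℝ) → ℝ := fun p => a p * b p * Hc p with hΨ
  set DΨ : (Fin 3 → ℝ) → (Fin 3 → ℝ) →L[ℝ] ℝ := fun p =>
    (a p * b p) • DH p + Hc p • (a p • Db p + b p • Da p) with hDΨ
  have hΨd : ∀ p, HasFDerivAt Ψ (DΨ p) p := fun p => ((had p).mul (hbd p)).mul (hHd p)
  have hΨc : Continuous Ψ := by
    have h0 : Continuous a := (continuous_chi _).comp (continuous_const.mul (continuous_apply 0))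
    have h1 : Continuous b := (continuous_chi _).comp (continuous_const.mul (continuous_apply 1))
    have h2 : Continuous Hc := (continuous_Hfun lam R).comp (continuous_apply 2)
    exact (h0.mul h1).mul h2
  have hDΨ_apply : ∀ p w, DΨ p w = a p * b p * (-kapR lam R (p 2) * w 2) +
      Hc p * (a p * (d p 1 * (R⁻¹ * w 1)) + b p * (d p 0 * (R⁻¹ * w 0))) := by
    intro p w
    simp only [hDΨ, hDH, hDa, hDb, hπ, ContinuousLinearMap.add_apply, ContinuousLinearMap.smul_apply,
      ContinuousLinearMap.proj_apply, smul_eq_mul]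
  -- values of the weight: lateral faces, top, bottom; size on the box
  have ha_face : ∀ p : Fin 3 → ℝ, |p 0| = R → a p = 0 := by
    intro p hp
    have : 2 * (1 / 2 : ℝ) ≤ |R⁻¹ * p 0| := by rw [abs_mul, abs_of_pos hRi, hp, inv_mul_cancel₀ hR0.ne']; norm_num
    exact chi_eq_zero (by norm_num) this
  have hb_face : ∀ p : Fin 3 → ℝ, |p 1| = R → b p = 0 := by
    intro p hp
    have : 2 * (1 / 2 : ℝ) ≤ |R⁻¹ * p 1| := by rw [abs_mul, abs_of_pos hRi, hp, inv_mul_cancel₀ hR0.ne']; norm_num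
    exact chi_eq_zero (by norm_num) this
  have hHc_top : ∀ p : Fin 3 → ℝ, p 2 = T → Hc p = 0 := by
    intro p hp; simp only [hHc, hp, hT4]; exact Hfun_top lam R
  have habs_a : ∀ p, |a p| ≤ 1 := fun p => abs_chi_le_one _ _
  have habs_b : ∀ p, |b p| ≤ 1 := fun p => abs_chi_le_one _ _
  have habs_H : ∀ p : Fin 3 → ℝ, 0 ≤ p 2 → p 2 ≤ T → |Hc p| ≤ T := fun p h0 h1 => abs_Hfun_le h0 h1
  -- ## the two fields
  set f₁ : (Fin 3 → ℝ) → (Fin 3 → ℝ) := fun p => Ψ p • g p with hf₁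
  set f₁' : (Fin 3 → ℝ) → (Fin 3 → ℝ) →L[ℝ] (Fin 3 → ℝ) := fun p => Ψ p • Dg p + (DΨ p).smulRight (g p) with hf₁'
  have hf₁d : ∀ p, HasFDerivAt f₁ (f₁' p) p := fun p => (hΨd p).smul (hgd p)
  have hf₁c : Continuous f₁ := hΨc.smul hgc
  set e2v : Fin 3 → ℝ := Pi.single 2 1 with he2v
  set f₂ : (Fin 3 → ℝ) → (Fin 3 → ℝ) := fun p => Ψ p • e2v with hf₂
  set f₂' : (Fin 3 → ℝ) → (Fin 3 → ℝ) →L[ℝ] (Fin 3 → ℝ) := fun p => (DΨ p).smulRight e2v with hf₂'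
  have hf₂d : ∀ p, HasFDerivAt f₂ (f₂' p) p := fun p => (hΨd p).smul_const e2v
  have hf₂c : Continuous f₂ := hΨc.smul continuous_const
  -- ## the divergences
  set θp : (Fin 3 → ℝ) → ℝ := fun p => a p * b p * kapR lam R (p 2) with hθp
  have hθp_eq : ∀ p, θp p = bump lam R (WithLp.toLp 2 p) := by
    intro p; simp only [hθp, ha, hb, kapR, bump_apply]
  set F : (Fin 3 → ℝ) → ℝ := fun p =>
    (Hc p * b p * d p 0 * R⁻¹) * g p 0 + (Hc p * a p * d p 1 * R⁻¹) * g p 1 with hF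
  have hdiv₁ : ∀ p, ∑ i, f₁' p (Pi.single i 1) i = F p - θp p * g p 2 := by
    intro p
    have happ : ∀ w i, f₁' p w i = Ψ p * Dg p w i + DΨ p w * g p i := by
      intro w i
      simp only [hf₁', ContinuousLinearMap.add_apply, ContinuousLinearMap.smul_apply,
        ContinuousLinearMap.smulRight_apply, Pi.add_apply, Pi.smul_apply, smul_eq_mul]
    simp only [Fin.sum_univ_three, happ, hDΨ_apply, hF, hθp, hΨ]
    simp only [Pi.single_apply, Fin.isValue, Fin.reduceEq, if_false, if_true]
    linear_combination (a p * b p * Hc p) * hdiv0 p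
  have hdiv₂ : ∀ p, ∑ i, f₂' p (Pi.single i 1) i = -θp p := by
    intro p
    have happ : ∀ w i, f₂' p w i = DΨ p w * e2v i := by
      intro w i
      simp only [hf₂', ContinuousLinearMap.smulRight_apply, Pi.smul_apply, smul_eq_mul]
    simp only [Fin.sum_univ_three, happ, hDΨ_apply, hθp, he2v]
    simp only [Pi.single_apply, Fin.isValue, Fin.reduceEq, if_false, if_true]
    ring
  -- continuity of the divergences
  have hdc : ∀ i, Continuous fun p : Fin 3 → ℝ => d p i := fun i =>
    ((contDiff_chi (1 / 2 : ℝ) (n := 1)).continuous_deriv le_rfl).comp (continuous_const.mul (continuous_apply i))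
  have hac : Continuous a := (continuous_chi _).comp (continuous_const.mul (continuous_apply 0))
  have hbc : Continuous b := (continuous_chi _).comp (continuous_const.mul (continuous_apply 1))
  have hHcc : Continuous Hc := (continuous_Hfun lam R).comp (continuous_apply 2)
  have hkc : Continuous fun p : Fin 3 → ℝ => kapR lam R (p 2) := (continuous_kapR lam R).comp (continuous_apply 2)
  have hgjc : ∀ j, Continuous fun p => g p j := fun j => (continuous_apply j).comp hgc
  have hFc : Continuous F := by
    simp only [hF]
    exact ((((hHcc.mul hbc).mul (hdc 0)).mul continuous_const).mul (hgjc 0)).add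
      ((((hHcc.mul hac).mul (hdc 1)).mul continuous_const).mul (hgjc 1))
  have hθpc : Continuous θp := by simp only [hθp]; exact (hac.mul hbc).mul hkc
  -- ## the divergence theorem, twice
  have hle := boxLo_le_boxHi hR0.le hT0.le
  have hHi₁ : IntegrableOn (fun p => ∑ i, f₁' p (Pi.single i 1) i) (Icc (![-R, -R, 0] : Fin 3 → ℝ) ![R, R, T]) := by
    rw [show (fun p => ∑ i, f₁' p (Pi.single i 1) i) = fun p => F p - θp p * g p 2 from funext hdiv₁]
    exact (hFc.sub (hθpc.mul (hgjc 2))).integrableOn_Icc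
  have hHi₂ : IntegrableOn (fun p => ∑ i, f₂' p (Pi.single i 1) i) (Icc (![-R, -R, 0] : Fin 3 → ℝ) ![R, R, T]) := by
    rw [show (fun p => ∑ i, f₂' p (Pi.single i 1) i) = fun p => -θp p from funext hdiv₂]
    exact hθpc.neg.integrableOn_Icc
  have hDT₁ := integral_divergence_of_hasFDerivAt_off_countable (![-R, -R, 0] : Fin 3 → ℝ) ![R, R, T] hle f₁ f₁' ∅
    countable_empty hf₁c.continuousOn (fun p _ => hf₁d p) hHi₁
  have hDT₂ := integral_divergence_of_hasFDerivAt_off_countable (![-R, -R, 0] : Fin 3 → ℝ) ![R, R, T] hle f₂ f₂' ∅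
    countable_empty hf₂c.continuousOn (fun p _ => hf₂d p) hHi₂
  -- face values
  have hf₁_apply : ∀ p i, f₁ p i = Ψ p * g p i := fun p i => rfl
  have hf₂_apply : ∀ p i, f₂ p i = Ψ p * e2v i := fun p i => rfl
  have hΨ0 : ∀ (c : ℝ) (y : Fin 2 → ℝ), |c| = R → Ψ (Fin.insertNth 0 c y) = 0 := by
    intro c y hc
    have : a (Fin.insertNth 0 c y) = 0 := ha_face _ (by rw [Fin.insertNth_apply_same]; exact hc)
    simp only [hΨ, this, zero_mul]
  have hΨ1 : ∀ (c : ℝ) (y : Fin 2 → ℝ), |c| = R → Ψ (Fin.insertNth 1 c y) = 0 := by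
    intro c y hc
    have : b (Fin.insertNth 1 c y) = 0 := hb_face _ (by rw [Fin.insertNth_apply_same]; exact hc)
    simp only [hΨ, this, mul_zero, zero_mul]
  have hΨtop : ∀ (y : Fin 2 → ℝ), Ψ (Fin.insertNth 2 T y) = 0 := by
    intro y
    have : Hc (Fin.insertNth 2 T y) = 0 := hHc_top _ (by rw [Fin.insertNth_apply_same])
    simp only [hΨ, this, mul_zero]
  have hR_abs : |R| = R := abs_of_pos hR0
  have hnR_abs : |(-R)| = R := by rw [abs_neg, hR_abs]
  have hhi0 : (![R, R, T] : Fin 3 → ℝ) 0 = R := rfl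
  have hhi1 : (![R, R, T] : Fin 3 → ℝ) 1 = R := rfl
  have hhi2 : (![R, R, T] : Fin 3 → ℝ) 2 = T := rfl
  have hlo0 : (![-R, -R, 0] : Fin 3 → ℝ) 0 = -R := rfl
  have hlo1 : (![-R, -R, 0] : Fin 3 → ℝ) 1 = -R := rfl
  have hlo2 : (![-R, -R, 0] : Fin 3 → ℝ) 2 = 0 := rfl
  -- bottom face: `g₂ = N` on the hot plane
  have hbot : ∀ y : Fin 2 → ℝ, g (Fin.insertNth 2 (0 : ℝ) y) 2 = N := by
    intro y
    rw [hg_apply]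
    apply hplane
    show (Fin.insertNth 2 (0 : ℝ) y : Fin 3 → ℝ) 2 = 0
    exact Fin.insertNth_apply_same _ _ _
  set S : ℝ := ∫ y in Icc ((![-R, -R, 0] : Fin 3 → ℝ) ∘ (2 : Fin 3).succAbove) ((![R, R, T] : Fin 3 → ℝ) ∘ (2 : Fin 3).succAbove),
    Ψ (Fin.insertNth 2 (0 : ℝ) y) with hS
  have hI₁ : ∫ p in Icc (![-R, -R, 0] : Fin 3 → ℝ) ![R, R, T], (F p - θp p * g p 2) = -(N * S) := by
    rw [← setIntegral_congr_fun measurableSet_Icc (fun p _ => hdiv₁ p), hDT₁, Fin.sum_univ_three]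
    simp only [hhi0, hhi1, hhi2, hlo0, hlo1, hlo2, hf₁_apply, hΨ0 R _ hR_abs, hΨ0 (-R) _ hnR_abs,
      hΨ1 R _ hR_abs, hΨ1 (-R) _ hnR_abs, hΨtop, hbot, zero_mul, integral_zero, sub_zero, zero_add, zero_sub]
    rw [integral_mul_const, hS]
    ring
  have hI₂ : ∫ p in Icc (![-R, -R, 0] : Fin 3 → ℝ) ![R, R, T], (-θp p) = -S := by
    rw [← setIntegral_congr_fun measurableSet_Icc (fun p _ => hdiv₂ p), hDT₂, Fin.sum_univ_three]
    simp only [hhi0, hhi1, hhi2, hlo0, hlo1, hlo2, hf₂_apply, hΨ0 R _ hR_abs, hΨ0 (-R) _ hnR_abs,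
      hΨ1 R _ hR_abs, hΨ1 (-R) _ hnR_abs, hΨtop, he2v, Pi.single_apply, zero_mul, integral_zero, sub_zero,
      zero_add, zero_sub]
    simp [hS]
  -- ## the flux identity on the box: `∫ θ (u₂ − N) = ∫ F`
  have hvol : volume (Icc (![-R, -R, 0] : Fin 3 → ℝ) ![R, R, T]) < ⊤ := isCompact_Icc.measure_lt_top
  have hFi : IntegrableOn F (Icc (![-R, -R, 0] : Fin 3 → ℝ) ![R, R, T]) := hFc.integrableOn_Icc
  have hθgi : IntegrableOn (fun p => θp p * g p 2) (Icc (![-R, -R, 0] : Fin 3 → ℝ) ![R, R, T]) :=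
    (hθpc.mul (hgjc 2)).integrableOn_Icc
  have hθi : IntegrableOn θp (Icc (![-R, -R, 0] : Fin 3 → ℝ) ![R, R, T]) := hθpc.integrableOn_Icc
  have hJ : (∫ p in Icc (![-R, -R, 0] : Fin 3 → ℝ) ![R, R, T], θp p * g p 2) -
      N * (∫ p in Icc (![-R, -R, 0] : Fin 3 → ℝ) ![R, R, T], θp p) =
      ∫ p in Icc (![-R, -R, 0] : Fin 3 → ℝ) ![R, R, T], F p := by
    have h1 : ∫ p in Icc (![-R, -R, 0] : Fin 3 → ℝ) ![R, R, T], (F p - θp p * g p 2) =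
        (∫ p in Icc (![-R, -R, 0] : Fin 3 → ℝ) ![R, R, T], F p) -
          ∫ p in Icc (![-R, -R, 0] : Fin 3 → ℝ) ![R, R, T], θp p * g p 2 := integral_sub hFi hθgi
    have h2 : ∫ p in Icc (![-R, -R, 0] : Fin 3 → ℝ) ![R, R, T], (-θp p) =
        -∫ p in Icc (![-R, -R, 0] : Fin 3 → ℝ) ![R, R, T], θp p := integral_neg _
    rw [h1] at hI₁
    rw [h2] at hI₂
    have hS' : S = ∫ p in Icc (![-R, -R, 0] : Fin 3 → ℝ) ![R, R, T], θp p := by linarith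
    rw [hS'] at hI₁
    linarith
  -- ## size of `F` on the box
  have hFbd : ∀ p ∈ Icc (![-R, -R, 0] : Fin 3 → ℝ) ![R, R, T], ‖F p‖ ≤ 8 * lam * D * B := by
    intro p hp
    have hp2 : 0 ≤ p 2 ∧ p 2 ≤ T := by
      have h1 := hp.1 2; have h2 := hp.2 2
      exact ⟨h1, h2⟩
    have hH := habs_H p hp2.1 hp2.2
    have hg0 : |g p 0| ≤ B := by
      rw [hg_apply, ← Real.norm_eq_abs]; exact (PiLp.norm_apply_le _ 0).trans (hBd _)
    have hg1 : |g p 1| ≤ B := by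
      rw [hg_apply, ← Real.norm_eq_abs]; exact (PiLp.norm_apply_le _ 1).trans (hBd _)
    have hd0 := hD (R⁻¹ * p 0)
    have hd1 := hD (R⁻¹ * p 1)
    have hRi' : |R⁻¹| = R⁻¹ := abs_of_pos hRi
    rw [Real.norm_eq_abs, hF]
    have e1 : |Hc p * b p * d p 0 * R⁻¹ * g p 0| ≤ T * 1 * D * R⁻¹ * B := by
      rw [abs_mul, abs_mul, abs_mul, abs_mul, hRi']
      gcongr
      · exact habs_b p
    have e2 : |Hc p * a p * d p 1 * R⁻¹ * g p 1| ≤ T * 1 * D * R⁻¹ * B := by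
      rw [abs_mul, abs_mul, abs_mul, abs_mul, hRi']
      gcongr
      · exact habs_a p
    have hTR : T * 1 * D * R⁻¹ * B = 4 * lam * D * B := by
      simp only [hT4]; field_simp
    calc _ ≤ |Hc p * b p * d p 0 * R⁻¹ * g p 0| + |Hc p * a p * d p 1 * R⁻¹ * g p 1| := abs_add_le _ _
      _ ≤ T * 1 * D * R⁻¹ * B + T * 1 * D * R⁻¹ * B := add_le_add e1 e2
      _ = 8 * lam * D * B := by rw [hTR]; ring
  have hvolR : volume.real (Icc (![-R, -R, 0] : Fin 3 → ℝ) ![R, R, T]) = 16 * lam * R ^ 3 := by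
    rw [measureReal_def, Real.volume_Icc_pi_toReal hle, Fin.prod_univ_three]
    simp only [Matrix.cons_val_zero, Matrix.cons_val_one, Matrix.cons_val_two, Matrix.head_cons, Matrix.tail_cons,
      sub_neg_eq_add, sub_zero, hT4]
    ring
  have hFint : |∫ p in Icc (![-R, -R, 0] : Fin 3 → ℝ) ![R, R, T], F p| ≤ 8 * lam * D * B * (16 * lam * R ^ 3) := by
    rw [← Real.norm_eq_abs, ← hvolR]
    exact norm_setIntegral_le_of_norm_le_const hvol hFbd
  -- ## back to `E3`
  have hbox1 : ∫ x, bump lam R x * v t x 2 = ∫ p in Icc (![-R, -R, 0] : Fin 3 → ℝ) ![R, R, T], θp p * g p 2 := by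
    rw [← setIntegral_eq_integral_of_forall_compl_eq_zero (s := {x : E3 | |x 0| ≤ R ∧ |x 1| ≤ R ∧ 0 ≤ x 2 ∧ x 2 ≤ T})
      (fun x hx => by rw [bump_eq_zero_off_box hlam hR0 (by simpa [hT4] using hx), zero_mul]), setIntegral_flatBox]
    refine setIntegral_congr_fun measurableSet_Icc fun p _ => ?_
    rw [hθp_eq, hg_apply]
  have hbox2 : ∫ x, bump lam R x = ∫ p in Icc (![-R, -R, 0] : Fin 3 → ℝ) ![R, R, T], θp p := by
    rw [← setIntegral_eq_integral_of_forall_compl_eq_zero (s := {x : E3 | |x 0| ≤ R ∧ |x 1| ≤ R ∧ 0 ≤ x 2 ∧ x 2 ≤ T})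
      (fun x hx => bump_eq_zero_off_box hlam hR0 (by simpa [hT4] using hx)), setIntegral_flatBox]
    exact setIntegral_congr_fun measurableSet_Icc fun p _ => (hθp_eq p).symm
  rw [hbox1, hbox2, hJ]
  calc |∫ p in Icc (![-R, -R, 0] : Fin 3 → ℝ) ![R, R, T], F p| ≤ 8 * lam * D * B * (16 * lam * R ^ 3) := hFint
    _ = (128 * D * B) * lam ^ 2 * R ^ 3 := by ring

/-! ### FB.5  FB proved -/

/-- **FB `bumpFluxTransport` — bump flux transport, PROVED** (product bumps `θ_R(x) = χ_{1/2}(x₀/R)χ_{1/2}(x₁/R)χ_λ(x₂/R − 2λ)`,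
mass `≥ 2λR³` from the inner box where `θ_R = 1`, flux defect `≤ 128·sup|χ'_{1/2}|·(C/√(−t))·λ²R³` from two applications of
the divergence theorem on `[−R,R]²×[0,4λR]` to `Ψu` and `Ψe₂`, `Ψ = χχH`, `H(z) = ∫_z^{4λR} χ_λ(s/R − 2λ) ds`). -/
theorem bumpFluxTransport : BumpFluxTransport := by
  intro C v hT hcont hmild hdiv t ht hplane
  obtain ⟨D, hD0, hD⟩ := exists_deriv_chi_bound
  have hB0 : 0 ≤ C / Real.sqrt (-t) := (norm_nonneg _).trans (hT t ht 0)
  refine ⟨2, 128 * D * (C / Real.sqrt (-t)), by norm_num, by positivity, fun lam hlam hlam4 => ?_⟩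
  obtain ⟨a, ha0, hfam⟩ := isBumpFamily_bump hlam hlam4
  exact ⟨a, bump lam, ha0, hfam, fun R hR => mass_bump hlam hlam4 hR,
    fun R hR => flux_bump hT hcont hmild hdiv ht hplane hD0 hD hlam hlam4 hR⟩

/-- Stub name of record (registered in v2 as the one open stub): now a theorem. -/
theorem stub_bumpFluxTransport : BumpFluxTransport := bumpFluxTransport


/-! ## Kernel: no hot plane, from ZB and FB -/

/-- **No hot plane** (VERBATIM `Lines/zero_mode.lean` v1.1): in the class, a plane on which the normal velocity is constant at one time
carries the value `0`. -/
def NoHotPlane : Prop :=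
  ∀ (C : ℝ) (v : ℝ → E3 → E3),
    HasTypeITimeDecay C v →
    ContinuousOn (uncurry v) (Iio (0 : ℝ) ×ˢ univ) →
    (∀ s t : ℝ, s < t → t < 0 → ∀ x, v t x = heatExtension (v s) (t - s) x - oseenDuhamel 1 s v v t x) →
    (∀ t < 0, VectorCalculus.IsDivFree (v t)) →
    ∀ t : ℝ, t < 0 → (∀ y : E3, y 2 = 0 → v t y 2 = v t 0 2) → v t 0 2 = 0

/-- **KERNEL `noHotPlane_of_bump : ZB → FB → NoHotPlane`** (sorry-free; real arithmetic).  With `N := v₂(t,0) ≠ 0`: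
`λ := min ¼ (μ|N|/(4(K+1)))`, `ε := μλ|N|/4` in ZB with `e = e₂`; at `R = R₀`: `|N|·μλR³ ≤ |N|∫θ_R ≤ |∫θ_R v₂| + Kλ²R³ ≤ μλ|N|R³/2`. -/
theorem noHotPlane_of_bump (hZ : ZeroModeBumpLaw) (hF : BumpFluxTransport) : NoHotPlane := by
  intro C v hrate hcont hmild hdiv t ht hplane
  by_contra hN
  set N : ℝ := v t 0 2 with hNdef
  have hNpos : 0 < |N| := abs_pos.mpr hN
  obtain ⟨μ, K, hμ, hK, hF'⟩ := hF C v hrate hcont hmild hdiv t ht hplane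
  -- the aspect ratio
  set lam : ℝ := min (1 / 4) (μ * |N| / (4 * (K + 1))) with hlam
  have hlam0 : 0 < lam := lt_min (by norm_num) (by positivity)
  have hlam4 : lam ≤ 1 / 4 := min_le_left _ _
  have hlamK : K * lam ≤ μ * |N| / 4 := by
    have h1 : lam ≤ μ * |N| / (4 * (K + 1)) := min_le_right _ _
    have h2 : K * lam ≤ (K + 1) * lam := by nlinarith
    have h3 : (K + 1) * lam ≤ (K + 1) * (μ * |N| / (4 * (K + 1))) := mul_le_mul_of_nonneg_left h1 (by positivity)
    have h4 : (K + 1) * (μ * |N| / (4 * (K + 1))) = μ * |N| / 4 := by field_simp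
    linarith
  obtain ⟨a, θ, ha, hθ, hmass, hflux⟩ := hF' lam hlam0 hlam4
  -- ZB with `e = e₂`, `ε = μλ|N|/4`
  obtain ⟨R₀, hR₀, hZ'⟩ := hZ C v hrate hcont hmild t ht a θ ha hθ (EuclideanSpace.single 2 1) (μ * lam * |N| / 4) (by positivity)
  set R : ℝ := R₀ with hRdef
  have hR1 : 1 ≤ R := hR₀
  have hR0 : 0 < R := by linarith
  have h₁ := hZ' R le_rfl
  have h₁' : |∫ x, θ R x * v t x 2| ≤ μ * lam * |N| / 4 * R ^ 3 := by
    have heq : (fun x => θ R x * ⟪v t x, EuclideanSpace.single 2 1⟫) = fun x => θ R x * v t x 2 := by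
      ext x
      rw [EuclideanSpace.inner_single_right]
      simp
    rw [heq] at h₁
    exact h₁
  have h₂ := hmass R hR1
  have h₃ := hflux R hR1
  set I : ℝ := ∫ x, θ R x * v t x 2 with hI
  set m : ℝ := ∫ x, θ R x with hm
  have hKR : K * lam ^ 2 * R ^ 3 ≤ μ * lam * |N| / 4 * R ^ 3 := by
    have : K * lam ^ 2 ≤ μ * |N| / 4 * lam := by nlinarith
    have hR3 : 0 ≤ R ^ 3 := by positivity
    nlinarith [mul_le_mul_of_nonneg_right this hR3]
  -- `|N| m ≤ |I| + |I − N m|`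
  have h₄ : |N| * m ≤ |I| + |I - N * m| := by
    have hm0 : 0 ≤ m := le_trans (by positivity) h₂
    calc |N| * m = |N * m| := by rw [abs_mul, abs_of_nonneg hm0]
      _ = |I - (I - N * m)| := by congr 1; ring
      _ ≤ |I| + |I - N * m| := abs_sub _ _
  have h₅ : |N| * (μ * lam * R ^ 3) ≤ |N| * m := mul_le_mul_of_nonneg_left h₂ (abs_nonneg _)
  have hpos : 0 < |N| * (μ * lam * R ^ 3) := by positivity
  nlinarith [h₁', h₃, h₄, h₅, hKR, hpos]

/-- **No hot plane on this line** (⇐ ZB (proved) ∧ FB (stub)). -/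
theorem zeroModeBump_noHotPlane : NoHotPlane :=
  noHotPlane_of_bump zeroModeBumpLaw stub_bumpFluxTransport

/-! ## Cell C1 of hot_split, VERBATIM (the three hypothesis packages as in `Lines/hot_split.lean` v1.2 / `Lines/zero_mode.lean` v1.1) -/

/-- **Pinned** — VERBATIM hot_split. -/
def Pinned (C : ℝ) (v : ℝ → E3 → E3) : Prop :=
  Literature.Analysis.FluidPDE.HasTypeITimeDecay C v ∧
  ContinuousOn (Function.uncurry v) (Set.Iio (0 : ℝ) ×ˢ Set.univ) ∧
  (∀ s t : ℝ, s < t → t < 0 → ∀ x, v t x =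
    Literature.Analysis.UnboundedOperators.heatExtension (v s) (t - s) x -
      Literature.Analysis.FluidPDE.oseenDuhamel 1 s v v t x) ∧
  (∀ t < 0, Literature.Analysis.FluidPDE.VectorCalculus.IsDivFree (v t)) ∧
  (∀ s < 0, ∀ y, ⟪Literature.Analysis.FluidPDE.curl (v s) y, EuclideanSpace.single 2 1⟫_ℝ = 0) ∧
  v (-1) 0 2 ≠ 0 ∧ (∀ t < 0, ∀ x, Real.sqrt (-t) * |v t x 2| ≤ |v (-1) 0 2|) ∧
  (∀ h : E3, fderiv ℝ (v (-1)) 0 h 2 = 0) ∧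
  (deriv (fun s => v s 0 2) (-1) = v (-1) 0 2 / 2 ∧ v (-1) 0 2 * (Δ (fun y => v (-1) y 2)) 0 ≤ 0)

/-- **ThickWindow** — VERBATIM hot_split. -/
def ThickWindow (v : ℝ → EuclideanSpace ℝ (Fin 3) → EuclideanSpace ℝ (Fin 3)) (W : Set (ℝ × EuclideanSpace ℝ (Fin 3))) : Prop :=
  IsOpen W ∧ W ⊆ Set.Iio (0 : ℝ) ×ˢ Set.univ ∧
  (∀ z ∈ W, (Literature.Analysis.FluidPDE.curl (v z.1) z.2 ≠ 0 ∧
      (fderiv ℝ (v z.1) z.2 (EuclideanSpace.single 0 1) 2 ≠ 0 ∨ fderiv ℝ (v z.1) z.2 (EuclideanSpace.single 1 1) 2 ≠ 0) ∧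
      (fderiv ℝ (v z.1) z.2 (EuclideanSpace.single 2 1) 0 ≠ 0 ∨ fderiv ℝ (v z.1) z.2 (EuclideanSpace.single 2 1) 1 ≠ 0)) ∧
    (fderiv ℝ (fun x => fderiv ℝ (v z.1) x (EuclideanSpace.single 2 1) 2) z.2 (EuclideanSpace.single 0 1) *
          fderiv ℝ (v z.1) z.2 (EuclideanSpace.single 1 1) 2 -
        fderiv ℝ (fun x => fderiv ℝ (v z.1) x (EuclideanSpace.single 2 1) 2) z.2 (EuclideanSpace.single 1 1) *
          fderiv ℝ (v z.1) z.2 (EuclideanSpace.single 0 1) 2 ≠ 0)) ∧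
  (∀ m : ℝ → ℝ → ℝ, ∀ W₁ : Set (ℝ × EuclideanSpace ℝ (Fin 3)), W₁ ⊆ W → IsOpen W₁ → W₁.Nonempty →
      ∃ z ∈ W₁, ∃ b : Fin 3, b ≠ 2 ∧
        fderiv ℝ (v z.1) z.2 (EuclideanSpace.single 2 1) b ≠
          m z.1 (z.2 2) * fderiv ℝ (v z.1) z.2 (EuclideanSpace.single b 1) 2) ∧
  (∀ r : ℝ, 0 < r → (Metric.ball ((-1 : ℝ), (0 : EuclideanSpace ℝ (Fin 3))) r ∩ W).Nonempty)

/-- **Peakless** — VERBATIM hot_split: no island bracket of `σ·v₂(s,·)` on any horizontal plane at any time `s < 0`. -/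
def Peakless (v : ℝ → EuclideanSpace ℝ (Fin 3) → EuclideanSpace ℝ (Fin 3)) : Prop :=
  ∀ (s z₀ σ M : ℝ) (K O : Set (EuclideanSpace ℝ (Fin 3))), s < 0 →
    ((σ = 1 ∨ σ = -1) ∧ IsCompact K ∧ K.Nonempty ∧ (∀ y ∈ K, y 2 = z₀ ∧ σ * v s y 2 = M) ∧
      IsOpen O ∧ K ⊆ O ∧ (∀ y ∈ O, y 2 = z₀ → σ * v s y 2 ≤ M) ∧
      (∀ y ∈ O, y 2 = z₀ → σ * v s y 2 = M → y ∈ K)) → False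

/-- **Cell C1 (hot plane ⇒ ∅) — the statement of hot_split's `stub_cellC1`, VERBATIM — from `NoHotPlane`.** -/
theorem cellC1_of_noHotPlane (hNHP : NoHotPlane) :
    ∀ (C : ℝ) (v : ℝ → E3 → E3) (W : Set (ℝ × E3)),
      Pinned C v → ThickWindow v W → Peakless v →
      (∀ y : E3, y 2 = 0 →
        v (-1) y = v (-1) 0 ∧ fderiv ℝ (fun x => v (-1) x 2) y (EuclideanSpace.single 2 1) = 0) →
      False := by
  intro C v W hP _hT _hK hplane
  obtain ⟨hrate, hcont, hmild, hdiv, -, hV, -⟩ := hP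
  have hconst : ∀ y : E3, y 2 = 0 → v (-1) y 2 = v (-1) 0 2 := fun y hy => by
    rw [(hplane y hy).1]
  exact hV (hNHP C v hrate hcont hmild hdiv (-1) (by norm_num) hconst)

/-- **hot_split's cell C1 on this line** (sorries only inside `stub_bumpFluxTransport`). -/
theorem zeroModeBump_cellC1 :
    ∀ (C : ℝ) (v : ℝ → E3 → E3) (W : Set (ℝ × E3)),
      Pinned C v → ThickWindow v W → Peakless v →
      (∀ y : E3, y 2 = 0 →
        v (-1) y = v (-1) 0 ∧ fderiv ℝ (fun x => v (-1) x 2) y (EuclideanSpace.single 2 1) = 0) →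
      False :=
  cellC1_of_noHotPlane zeroModeBump_noHotPlane

end Summit.NavierStokesRegularity.NavierStokesRegularity.Cruxes.PoloidalWindowRigidity.ZeroModeBump

end
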